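import Literature.MathematicalPhysics.QuantumLattice.HubbardTTPrimeHotFreeEnergyBoundUTransport
import Literature.MathematicalPhysics.QuantumLattice.HubbardThermalAxisWindowAllTori
import Literature.MathematicalPhysics.QuantumLattice.HubbardTorusTTPrimeMarkovPressureClusterBound
import HarnessLib

/-!
# Pressure FLOORS move along `U` on the torus side: free below the anchor, at the double-occupancy price
# above it, the `U`-staircase with certified thermal docc words, and the cross-corner `U`-cell editions of
# the temperature-axis energy windows

Family `hubbard` (topic `MathematicalPhysics/QuantumLattice`), written for stage S2 of the Hubbard material-oracle
programme («robustness lemmas consumed by S2: monotonicity/Lipschitz of certified words in `(t′, U, μ)` so a parameter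
BOX maps to a certified word», seat hubbard-downfold-unc-1 = the `U` direction). The `T > 0` energy windows of
`HubbardThermalAxisWindow[AllTori]`, the entropy rows of `TorusSectorGibbsEntropyRowPressureInput`, the `β`-staircase of
`TorusSectorPressureStaircase` and the Kosterlitz–Thouless dictionary plugs all consume ONE input shape, a
PRESSURE FLOOR along the tori defining a thermal torus limit,
`hW : ∀ ε > 0, ∀ᶠ j, (W − ε)·(Ls j)² ≤ log Re Z_β(H_{Ls j}(t,s,U)|_sector)` (or the `ℓ·L² ≤ log Re Z` shape of the
chords), produced today by the C2 type class (`TorusSectorPressureTypeBound[AllTori]`), the `7/8` open-box tilings and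
the zero anchor. This file moves that input along the interaction `U` (Peierls–Bogoliubov: `U ↦ log Z_β(H(U))` is
convex and ANTITONE, with slope `−β⟨D⟩_{β,U}`, `D = Σ_x n_{x↑}n_{x↓} ≥ 0`, and the thermal docc mean is antitone in
`U`), complementing the CEILING side already in the tree (`HubbardTTPrimeHotFreeEnergyBoundUTransport` §2/§4: hot caps
move down in `U` at the docc price, `HubbardTTPrimeOpenBoxPartitionFnCouplingTransport` §4: up in `U` for free) and the
`t'`-leg (`HubbardTTPrimeDiagHopTransportThermal` §8–§10):

* §1 finite volume: `log Re Z(U₀) − β(U − U₀)·(n/2)·L² ≤ log Re Z(U)` for `U ≥ U₀`, the two-sided `max` form valid at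
  every `U`, and the kinematic Lipschitz bound `|log Re Z(U₁) − log Re Z(U₂)| ≤ β(n/2)L²|U₁ − U₂|`.
* §2 eventual forms along `Ls → ∞`: a floor moves DOWN in `U` for free (`eventually_le_log_partitionFn_…_of_le_U`, any
  right-hand side), a ceiling UP for free (any right-hand side), and a floor moves to ANY `U` at the kinematic price
  `β·max(U − U₀, 0)·n/2` per site, in the `ℓ·L²` shape (`eventually_mul_sq_le_log_partitionFn_sector_of_U`) and in the
  `hW` shape (`eventually_pressureFloor_of_anchorU_kinematic`); the `hu`-shape kinematic ceiling move for symmetry.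
* §3 a certified thermal docc FLOOR word is an eventual finite-volume slope (compactness; the twin of
  `eventually_sectorGibbs_doccMean_le_of_forall`).
* §4 WORD-PRICED and WORD-GAINING single steps in the `hW` / `hu` shapes: a floor moves up by `β(U − U₀)·A` with a docc
  CEILING word `A` at (or left of) the anchor; a floor moves down GAINING `β(U₀ − U)·B` with a docc FLOOR word `B` at (or
  right of) the anchor; a ceiling moves up gaining `β(U − U₀)·B` with a floor word at (or right of) the target; a ceiling
  moves down at the price `β(U₀ − U)·A` with a ceiling word at (or left of) the target (the `ε` of the eventual slope is
  absorbed into the `∀ ε` of the shape: the price is exactly `β·ΔU·A`).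
* §5 THE `U`-STAIRCASE (coupling-constant integration `π(U_N) = π(U₀) − β∫⟨D⟩ dU` with one-sided Riemann sums, the twin
  of the `β`-staircase): along a grid `u₀ ≤ u₁ ≤ … ≤ u_N`, docc ceiling words `A_i` at the LEFT ends price the moves
  `W_N = W₀ − β Σ_i (u_{i+1} − u_i) A_i` (floor to the right) and `u⁺_0 = u⁺_N + β Σ_i (u_{i+1} − u_i) A_i` (ceiling to the
  left); docc floor words `B_{i+1}` at the RIGHT ends are gains for the two free directions.
* §6 compositions: the C2 type-class floor certified at ONE anchor `U₀` is an `hW` input at every `U` (free below,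
  kinematic or word-priced above: `eventually_typeFreeEntropy_mul_sq_le_log_partitionFn_allTori_of_anchorU[_kinematic]`),
  and the CROSS-CORNER `U`-CELL editions of the temperature-axis windows: a pressure floor at `β` certified at the RIGHT
  end `U₂` and a pressure ceiling at `β_h < β` (resp. `β_c > β`) certified at the LEFT end `U₁` bound the thermal energy
  of EVERY torus limit at EVERY `U ∈ [U₁, U₂]` with NO transport price (both inputs move in their free directions):
  `IsTorusLimitOfMixture.meanEnergy_hubbardTTPrime_le_of_pressure_bounds_UCell` / `…le_meanEnergy…_UCell`, and the
  certificate editions `…_of_typeClass_right_of_rectMarkovCertificate_left_UCell_allTori` (C2 at `U₂`, C1 at `U₁`).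
* §7 (appended) thermal docc WORDS from two pressure inputs (the `U`-chord readout): a ceiling at `U₁` and a floor at
  `U₂ > U₁` (same `β`) give `D(ω) ≤ (u − W)/(β(U₂ − U₁))` for every torus limit at every `U ≥ U₂`; a floor at `U₁` and a
  ceiling at `U₂` give the docc FLOOR `(W − u)/(β(U₂ − U₁))` at every `U ≤ U₁` — the pressure table produces its own
  docc-word currency (`IsTorusLimitOfMixture.meanEnergy_onSite_le_of_pressure_bounds_U[_allTori]`, C2 editions).
* §8 (appended) the cross-corner `U`-cell windows at `t' ≠ 0` (C2 at `U₂`, the `t–t'` rectangle Markov certificate of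
  `HubbardTorusTTPrimeMarkovPressureClusterBound` at `U₁`): `…_of_typeClass_right_of_rectMarkovCertificateTT'_left_UCell_allTori`.

Everything is PROVED; no definition, no named fact, no number. HONEST SCOPE: first-order transport only (the price is
`|ΔU| ×` a docc bracket, exactly as for the `T = 0` energy words of `HubbardTTPrimeUBoxWords`); nothing here moves a
word in `β` (that is `TorusSectorPressureStaircase` / `GibbsLogPartitionTemperatureCouplingConvexity`); the cell editions
are wider than the same-point windows by the `U`-variation of the two pressures across the cell. WHAT THIS IS NOT: no
certificate, no phase sentence.

## Mathlib / tree search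

REUSED: `log_partitionFn_sector_sub_mem_Icc_U`, `IsTorusLimitOfMixture.meanEnergy_onSite_le_of_forall_left_U_of_sectorGibbs`,
`…le_meanEnergy_onSite_of_forall_right_U_of_sectorGibbs` (`HubbardTTPrimeDoccTransportThermal`),
`sectorGibbs_doccMean_le_half_density_mul_sq`, `sectorGibbs_doccMean_nonneg`, `eventually_sectorGibbs_doccMean_le_of_forall`,
`eventually_log_partitionFn_sectorHamiltonianTT'_le_of_anchorU`, `…_le_of_doccWord_left_U`
(`HubbardTTPrimeHotFreeEnergyBoundUTransport`), `log_partitionFn_sectorHamiltonianTT'_anti_U`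
(`HubbardTTPrimeOpenBoxPartitionFnCouplingTransport`), `exists_isTorusLimitOfMixture_sectorGibbs`,
`IsTorusLimitOfMixture.tendsto_meanEnergy_hubbardTTPrime`, `IsTorusLimitOfMixture.meanEnergy_hubbardTTPrime_le_of_eventually_pressure_bounds`,
`…le_meanEnergy_hubbardTTPrime_of_eventually_pressure_bounds` (`HubbardThermalAxisWindow`),
`InfVolFermionState.eventually_typeFreeEntropy_mul_sq_le_log_partitionFn_allTori` (`TorusSectorPressureTypeBoundAllTori`),
`eventually_log_partitionFn_sectorHamiltonianTT'_le_of_clusterCertificate` and the rectangle-window bookkeeping of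
`HubbardThermalAxisWindowAllTori`. `rg 'eventually_mul_sq_le_log_partitionFn.*U|pressureFloor.*U|staircase_U'` over
`Literature/MathematicalPhysics/QuantumLattice` (2026-08-27): nothing — only the `t'`-leg and the ceiling side existed.

## References

* E. H. Lieb, Commun. Math. Phys. 31 (1973) 327, §V (5.2)–(5.4) (Peierls–Bogoliubov). [cite: Lieb1973, §V (5.2)–(5.4)]
* R. B. Israel, *Convexity in the Theory of Lattice Gases* (1979), Theorem I.3.4, Lemma II.3.1. [cite: Israel1979, Thm. I.3.4]
* S. J. Gustafson, I. M. Sigal, *Mathematical Concepts of Quantum Mechanics*, §18.3 (convexity of the pressure,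
  thermodynamic integration). [cite: GustafsonSigal2003, §18.3]
* O. Bratteli, D. W. Robinson, *Operator Algebras and Quantum Statistical Mechanics I* (1987), Thm. 2.3.15.
  [cite: BratteliRobinsonI1987, Thm. 2.3.15 (weak-⋆ compactness of the state space) and §4.3.1]
* D. Ruelle, *Statistical Mechanics: Rigorous Results* (1969), §3.3. [cite: Ruelle1969, §3.3]
-/

noncomputable section

namespace Literature.MathematicalPhysics.QuantumLattice

open Matrix Finset HubbardWave0 ThermodynamicLimit LiebThm1 AndersonCluster Literature.Probability.LatticeModels
open _root_.Filter
open scoped _root_.Topology ComplexOrder BigOperators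

/-! ### §1 Finite volume: the floor side of the Peierls–Bogoliubov bracket along `U` -/

section Torus

variable {n : ℝ}

/-- **A canonical-sector `log`-partition-function FLOOR moves UP in `U` at the kinematic price** (`0 ≤ n ≤ 2`,
`β ≥ 0`, `L ≥ 1`): for `U₀ ≤ U`,
`log Re Z_β(H_L(t,s,U₀)|_s) − β(U − U₀)·(n/2)·L² ≤ log Re Z_β(H_L(t,s,U)|_s)` (lower Peierls–Bogoliubov tangent at
the anchor, thermal docc of the anchor at most `n/2` per site). [cite: Lieb1973, §V (5.2)–(5.4)] -/
theorem log_partitionFn_sectorHamiltonianTT'_sub_le_of_le_U (hn0 : 0 ≤ n) (hn2 : n ≤ 2) (L : ℕ) [NeZero L]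
    (t s : ℝ) {β : ℝ} (hβ : 0 ≤ β) {U₀ U : ℝ} (hU : U₀ ≤ U) :
    Real.log (partitionFn β (sectorHamiltonianTT' t s U₀ n L)).re - β * (U - U₀) * (n / 2 * (L : ℝ) ^ 2) ≤
      Real.log (partitionFn β (sectorHamiltonianTT' t s U n L)).re := by
  have hb := (log_partitionFn_sector_sub_mem_Icc_U hn0 hn2 L t s β U₀ U).2
  have hd := sectorGibbs_doccMean_le_half_density_mul_sq hn0 hn2 L β t s U₀
  have hc : 0 ≤ β * (U - U₀) := mul_nonneg hβ (sub_nonneg.2 hU)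
  have hm := mul_le_mul_of_nonneg_left hd hc
  nlinarith [hb, hm]

/-- **Two-sided form, valid at EVERY `U`** (`β ≥ 0`):
`log Re Z_β(H_L(t,s,U₀)|_s) − β·max(U − U₀, 0)·(n/2)·L² ≤ log Re Z_β(H_L(t,s,U)|_s)` — below the anchor the floor
moves for free (`log Z` is antitone in `U`). [cite: Lieb1973, §V (5.2)–(5.4)] [cite: Israel1979, Thm. I.3.4] -/
theorem log_partitionFn_sectorHamiltonianTT'_sub_max_le (hn0 : 0 ≤ n) (hn2 : n ≤ 2) (L : ℕ) [NeZero L]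
    (t s : ℝ) {β : ℝ} (hβ : 0 ≤ β) (U U₀ : ℝ) :
    Real.log (partitionFn β (sectorHamiltonianTT' t s U₀ n L)).re -
        β * max (U - U₀) 0 * (n / 2 * (L : ℝ) ^ 2) ≤
      Real.log (partitionFn β (sectorHamiltonianTT' t s U n L)).re := by
  rcases le_total U₀ U with hU | hU
  · rw [max_eq_left (sub_nonneg.2 hU)]
    exact log_partitionFn_sectorHamiltonianTT'_sub_le_of_le_U hn0 hn2 L t s hβ hU
  · rw [max_eq_right (sub_nonpos.2 hU), mul_zero, zero_mul, sub_zero]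
    exact log_partitionFn_sectorHamiltonianTT'_anti_U hn0 hn2 L t s hβ hU

/-- **Kinematic Lipschitz bound for the sector free energy along `U`** (finite volume, `β ≥ 0`, `0 ≤ n ≤ 2`):
`|log Re Z_β(H_L(t,s,U₁)|_s) − log Re Z_β(H_L(t,s,U₂)|_s)| ≤ β·(n/2)·L²·|U₁ − U₂|` — the Peierls–Bogoliubov bracket
with the thermal docc means in `[0, (n/2)L²]` at both ends (the `U`-twin of `abs_log_partitionFn_sector_sub_le_tPrime`).
[cite: Lieb1973, §V (5.2)–(5.4)] -/
theorem abs_log_partitionFn_sectorHamiltonianTT'_sub_le_U (hn0 : 0 ≤ n) (hn2 : n ≤ 2) (L : ℕ) [NeZero L]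
    (t s : ℝ) {β : ℝ} (hβ : 0 ≤ β) (U₁ U₂ : ℝ) :
    |Real.log (partitionFn β (sectorHamiltonianTT' t s U₁ n L)).re -
        Real.log (partitionFn β (sectorHamiltonianTT' t s U₂ n L)).re| ≤
      β * (n / 2 * (L : ℝ) ^ 2) * |U₁ - U₂| := by
  -- the two one-sided moves, `max(x, 0) ≤ |x|`
  have hn2' : 0 ≤ n / 2 := by linarith
  have hK0 : 0 ≤ β * (n / 2 * (L : ℝ) ^ 2) := mul_nonneg hβ (mul_nonneg hn2' (by positivity))
  have h1 := log_partitionFn_sectorHamiltonianTT'_sub_max_le hn0 hn2 L t s hβ U₂ U₁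
  have h2 := log_partitionFn_sectorHamiltonianTT'_sub_max_le hn0 hn2 L t s hβ U₁ U₂
  have hmax1 : max (U₂ - U₁) 0 ≤ |U₁ - U₂| :=
    max_le (by rw [abs_sub_comm]; exact le_abs_self _) (abs_nonneg _)
  have hmax2 : max (U₁ - U₂) 0 ≤ |U₁ - U₂| := max_le (le_abs_self _) (abs_nonneg _)
  have e1 : β * max (U₂ - U₁) 0 * (n / 2 * (L : ℝ) ^ 2) ≤ β * (n / 2 * (L : ℝ) ^ 2) * |U₁ - U₂| := by
    have h := mul_le_mul_of_nonneg_left hmax1 hK0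
    linarith
  have e2 : β * max (U₁ - U₂) 0 * (n / 2 * (L : ℝ) ^ 2) ≤ β * (n / 2 * (L : ℝ) ^ 2) * |U₁ - U₂| := by
    have h := mul_le_mul_of_nonneg_left hmax2 hK0
    linarith
  rw [abs_sub_le_iff]
  constructor
  · linarith
  · linarith

/-! ### §2 Eventual forms along the tori defining a torus limit -/

/-- **A pressure FLOOR moves DOWN in `U` for free** (any right-hand side): if eventually along `Ls → ∞`
`X_j ≤ log Re Z_β(H_{Ls j}(t,s,U₀)|_s)`, then the same holds at every `U ≤ U₀` (`0 ≤ n ≤ 2`, `β ≥ 0`).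
[cite: Israel1979, Thm. I.3.4] -/
theorem eventually_le_log_partitionFn_sectorHamiltonianTT'_of_le_U (hn0 : 0 ≤ n) (hn2 : n ≤ 2) (t s : ℝ)
    {β : ℝ} (hβ : 0 ≤ β) {U U₀ : ℝ} (hU : U ≤ U₀) {Ls : ℕ → ℕ} (hLs : Tendsto Ls atTop atTop) {X : ℕ → ℝ}
    (hX : ∀ᶠ j in atTop, X j ≤ Real.log (partitionFn β (sectorHamiltonianTT' t s U₀ n (Ls j))).re) :
    ∀ᶠ j in atTop, X j ≤ Real.log (partitionFn β (sectorHamiltonianTT' t s U n (Ls j))).re := by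
  filter_upwards [hX, hLs.eventually_ge_atTop 1] with j hj hj1
  haveI : NeZero (Ls j) := ⟨by omega⟩
  exact hj.trans (log_partitionFn_sectorHamiltonianTT'_anti_U hn0 hn2 (Ls j) t s hβ hU)

/-- **A pressure CEILING moves UP in `U` for free** (any right-hand side): if eventually along `Ls → ∞`
`log Re Z_β(H_{Ls j}(t,s,U₀)|_s) ≤ X_j`, then the same holds at every `U ≥ U₀` (`0 ≤ n ≤ 2`, `β ≥ 0`) — the shape-free
form of `eventually_log_partitionFn_sectorHamiltonianTT'_le_of_le_U`. [cite: Israel1979, Thm. I.3.4] -/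
theorem eventually_log_partitionFn_sectorHamiltonianTT'_le_fun_of_le_U (hn0 : 0 ≤ n) (hn2 : n ≤ 2) (t s : ℝ)
    {β : ℝ} (hβ : 0 ≤ β) {U₀ U : ℝ} (hU : U₀ ≤ U) {Ls : ℕ → ℕ} (hLs : Tendsto Ls atTop atTop) {X : ℕ → ℝ}
    (hX : ∀ᶠ j in atTop, Real.log (partitionFn β (sectorHamiltonianTT' t s U₀ n (Ls j))).re ≤ X j) :
    ∀ᶠ j in atTop, Real.log (partitionFn β (sectorHamiltonianTT' t s U n (Ls j))).re ≤ X j := by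
  filter_upwards [hX, hLs.eventually_ge_atTop 1] with j hj hj1
  haveI : NeZero (Ls j) := ⟨by omega⟩
  exact (log_partitionFn_sectorHamiltonianTT'_anti_U hn0 hn2 (Ls j) t s hβ hU).trans hj

/-- **Eventual transport of a free-energy LOWER input along `U` (kinematic, `ℓ·L²` shape).** If along `Ls → ∞`
eventually `ℓ·L² ≤ log Re Z_β(H_L(t,s,U₀)|_s)` (`β ≥ 0`, `0 ≤ n ≤ 2`), then for every `U` eventually
`(ℓ − β·max(U − U₀, 0)·n/2)·L² ≤ log Re Z_β(H_L(t,s,U)|_s)` — the cold/target inputs of the chords certified at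
the anchor serve at every `U` at this price (none below the anchor). [cite: Lieb1973, §V (5.2)–(5.4)]
[cite: Israel1979, Thm. I.3.4] -/
theorem eventually_mul_sq_le_log_partitionFn_sector_of_U (hn0 : 0 ≤ n) (hn2 : n ≤ 2) (t s : ℝ) {β : ℝ}
    (hβ : 0 ≤ β) (U₀ U : ℝ) {Ls : ℕ → ℕ} (hLs : Tendsto Ls atTop atTop) {ℓ : ℝ}
    (hℓ : ∀ᶠ j in atTop, ℓ * (Ls j : ℝ) ^ 2 ≤
      Real.log (partitionFn β (sectorHamiltonianTT' t s U₀ n (Ls j))).re) :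
    ∀ᶠ j in atTop, (ℓ - β * max (U - U₀) 0 * (n / 2)) * (Ls j : ℝ) ^ 2 ≤
      Real.log (partitionFn β (sectorHamiltonianTT' t s U n (Ls j))).re := by
  filter_upwards [hℓ, hLs.eventually_ge_atTop 1] with j hj hj1
  haveI : NeZero (Ls j) := ⟨by omega⟩
  have h := log_partitionFn_sectorHamiltonianTT'_sub_max_le hn0 hn2 (Ls j) t s hβ U U₀
  nlinarith [h, hj]

/-- **The `hW` pressure-floor input at the anchor is an `hW` input at every `U`, kinematic price**: from
`∀ ε > 0, ∀ᶠ j, (W − ε)(Ls j)² ≤ log Re Z_β(H(t,s,U₀)|_s)` to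
`∀ ε > 0, ∀ᶠ j, (W − β·max(U − U₀, 0)·n/2 − ε)(Ls j)² ≤ log Re Z_β(H(t,s,U)|_s)` — the shape consumed by
`HubbardThermalAxisWindow`, the entropy rows and the `β`-staircase. [cite: Lieb1973, §V (5.2)–(5.4)]
[cite: Israel1979, Thm. I.3.4] -/
theorem eventually_pressureFloor_of_anchorU_kinematic (hn0 : 0 ≤ n) (hn2 : n ≤ 2) (t s : ℝ) {β : ℝ}
    (hβ : 0 ≤ β) (U₀ U : ℝ) {Ls : ℕ → ℕ} (hLs : Tendsto Ls atTop atTop) {W : ℝ}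
    (hW : ∀ ε : ℝ, 0 < ε → ∀ᶠ j in atTop,
      (W - ε) * (Ls j : ℝ) ^ 2 ≤ Real.log (partitionFn β (sectorHamiltonianTT' t s U₀ n (Ls j))).re)
    {ε : ℝ} (hε : 0 < ε) :
    ∀ᶠ j in atTop, (W - β * max (U - U₀) 0 * (n / 2) - ε) * (Ls j : ℝ) ^ 2 ≤
      Real.log (partitionFn β (sectorHamiltonianTT' t s U n (Ls j))).re := by
  have h := eventually_mul_sq_le_log_partitionFn_sector_of_U hn0 hn2 t s hβ U₀ U hLs (hW ε hε)
  refine h.mono fun j hj => ?_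
  have e : W - β * max (U - U₀) 0 * (n / 2) - ε = W - ε - β * max (U - U₀) 0 * (n / 2) := by ring
  rw [e]
  exact hj

/-- **The `hW` input moves DOWN in `U` unchanged**: `U ≤ U₀` ⇒ the `hW` floor `W` certified at `U₀` is an `hW`
floor `W` at `U`. [cite: Israel1979, Thm. I.3.4] -/
theorem eventually_pressureFloor_of_le_U (hn0 : 0 ≤ n) (hn2 : n ≤ 2) (t s : ℝ) {β : ℝ} (hβ : 0 ≤ β)
    {U U₀ : ℝ} (hU : U ≤ U₀) {Ls : ℕ → ℕ} (hLs : Tendsto Ls atTop atTop) {W : ℝ}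
    (hW : ∀ ε : ℝ, 0 < ε → ∀ᶠ j in atTop,
      (W - ε) * (Ls j : ℝ) ^ 2 ≤ Real.log (partitionFn β (sectorHamiltonianTT' t s U₀ n (Ls j))).re)
    {ε : ℝ} (hε : 0 < ε) :
    ∀ᶠ j in atTop, (W - ε) * (Ls j : ℝ) ^ 2 ≤
      Real.log (partitionFn β (sectorHamiltonianTT' t s U n (Ls j))).re :=
  eventually_le_log_partitionFn_sectorHamiltonianTT'_of_le_U hn0 hn2 t s hβ hU hLs (hW ε hε)

/-- **The `hu` pressure-ceiling input at the anchor is an `hu` input at every `U`, kinematic price** (the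
`ε`-shape of `eventually_log_partitionFn_sectorHamiltonianTT'_le_of_anchorU`): from
`∀ ε > 0, ∀ᶠ j, log Re Z_β(H(t,s,U₀)|_s) ≤ (u + ε)(Ls j)²` to
`∀ ε > 0, ∀ᶠ j, log Re Z_β(H(t,s,U)|_s) ≤ (u + β·max(U₀ − U, 0)·n/2 + ε)(Ls j)²`.
[cite: Lieb1973, §V (5.2)–(5.4)] [cite: Israel1979, Thm. I.3.4] -/
theorem eventually_pressureCeiling_of_anchorU_kinematic (hn0 : 0 ≤ n) (hn2 : n ≤ 2) (t s : ℝ) {β : ℝ}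
    (hβ : 0 ≤ β) (U₀ U : ℝ) {Ls : ℕ → ℕ} (hLs : Tendsto Ls atTop atTop) {u : ℝ}
    (hu : ∀ ε : ℝ, 0 < ε → ∀ᶠ j in atTop,
      Real.log (partitionFn β (sectorHamiltonianTT' t s U₀ n (Ls j))).re ≤ (u + ε) * (Ls j : ℝ) ^ 2)
    {ε : ℝ} (hε : 0 < ε) :
    ∀ᶠ j in atTop, Real.log (partitionFn β (sectorHamiltonianTT' t s U n (Ls j))).re ≤
      (u + β * max (U₀ - U) 0 * (n / 2) + ε) * (Ls j : ℝ) ^ 2 := by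
  have hu' : ∀ᶠ j in atTop, Real.log (partitionFn β (sectorHamiltonianTT' t s U₀ n (Ls j))).re ≤
      (u + ε) * (Ls j : ℝ) ^ 2 + 0 := (hu ε hε).mono fun j hj => by rw [add_zero]; exact hj
  have h := eventually_log_partitionFn_sectorHamiltonianTT'_le_of_anchorU hn0 hn2 t s hβ U U₀ hLs hu'
  refine h.mono fun j hj => ?_
  have e : (u + β * max (U₀ - U) 0 * (n / 2) + ε) * (Ls j : ℝ) ^ 2 =
      (u + ε + β * max (U₀ - U) 0 * (n / 2)) * (Ls j : ℝ) ^ 2 + 0 := by ring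
  rw [e]
  exact hj

/-! ### §5a Finite-volume `U`-staircases (one-sided Riemann sums of `∂_U log Z = −β⟨D⟩`) -/

/-- **Finite-volume `U`-staircase, docc CEILINGS at the left ends** (`0 ≤ n ≤ 2`, `β ≥ 0`, `L ≥ 1`): along a
monotone grid `u₀ ≤ u₁ ≤ … ≤ u_N`, if the thermal docc mean of the sector Gibbs state at `u_i` is at most `M_i`
(`i < N`), then `log Re Z(u₀) − log Re Z(u_N) ≤ β Σ_{i<N} (u_{i+1} − u_i)·M_i` (iterate the upper Peierls–Bogoliubov
tangent). [cite: Lieb1973, §V (5.2)–(5.4)] [cite: GustafsonSigal2003, §18.3] -/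
theorem log_partitionFn_sector_sub_le_sum_U (hn0 : 0 ≤ n) (hn2 : n ≤ 2) (L : ℕ) [NeZero L] (t s : ℝ)
    {β : ℝ} (hβ : 0 ≤ β) {u : ℕ → ℝ} (hu : Monotone u) (N : ℕ) {M : ℕ → ℝ}
    (hM : ∀ i < N, ∑ k, sectorGibbsWeightTT' β t s (u i) n L k *
        (expect (hubbardTorusTT' L 0 0 1) (sectorGibbsVectorTT' t s (u i) n L k)).re ≤ M i) :
    Real.log (partitionFn β (sectorHamiltonianTT' t s (u 0) n L)).re -
        Real.log (partitionFn β (sectorHamiltonianTT' t s (u N) n L)).re ≤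
      β * ∑ i ∈ Finset.range N, (u (i + 1) - u i) * M i := by
  induction N with
  | zero => simp
  | succ N ih =>
    have ih' := ih fun i hi => hM i (Nat.lt_succ_of_lt hi)
    have hb := (log_partitionFn_sector_sub_mem_Icc_U hn0 hn2 L t s β (u N) (u (N + 1))).2
    have hstep := mul_le_mul_of_nonneg_left
      (mul_le_mul_of_nonneg_left (hM N (Nat.lt_succ_self N)) (sub_nonneg.2 (hu (Nat.le_succ N)))) hβ
    rw [Finset.sum_range_succ, mul_add]
    linarith

/-- **Finite-volume `U`-staircase, docc FLOORS at the right ends**: along a monotone grid, if the thermal docc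
mean at `u_{i+1}` is at least `M'_{i+1}` (`i < N`), then
`β Σ_{i<N} (u_{i+1} − u_i)·M'_{i+1} ≤ log Re Z(u₀) − log Re Z(u_N)` (iterate the lower tangent; `β ≥ 0`).
[cite: Lieb1973, §V (5.2)–(5.4)] [cite: GustafsonSigal2003, §18.3] -/
theorem sum_le_log_partitionFn_sector_sub_U (hn0 : 0 ≤ n) (hn2 : n ≤ 2) (L : ℕ) [NeZero L] (t s : ℝ)
    {β : ℝ} (hβ : 0 ≤ β) {u : ℕ → ℝ} (hu : Monotone u) (N : ℕ) {M' : ℕ → ℝ}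
    (hM' : ∀ i < N, M' (i + 1) ≤ ∑ k, sectorGibbsWeightTT' β t s (u (i + 1)) n L k *
        (expect (hubbardTorusTT' L 0 0 1) (sectorGibbsVectorTT' t s (u (i + 1)) n L k)).re) :
    β * ∑ i ∈ Finset.range N, (u (i + 1) - u i) * M' (i + 1) ≤
      Real.log (partitionFn β (sectorHamiltonianTT' t s (u 0) n L)).re -
        Real.log (partitionFn β (sectorHamiltonianTT' t s (u N) n L)).re := by
  induction N with
  | zero => simp
  | succ N ih =>
    have ih' := ih fun i hi => hM' i (Nat.lt_succ_of_lt hi)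
    have hb := (log_partitionFn_sector_sub_mem_Icc_U hn0 hn2 L t s β (u N) (u (N + 1))).1
    have hstep := mul_le_mul_of_nonneg_left
      (mul_le_mul_of_nonneg_left (hM' N (Nat.lt_succ_self N)) (sub_nonneg.2 (hu (Nat.le_succ N)))) hβ
    rw [Finset.sum_range_succ, mul_add]
    linarith

end Torus

/-! ### §3 A certified thermal docc FLOOR word is an eventual finite-volume slope (compactness) -/

namespace InfVolFermionState

section Words

variable {t s n β : ℝ}

/-- **A thermal docc-FLOOR word bounds the finite-volume thermal docc means from below eventually** (the floor twin
of `eventually_sectorGibbs_doccMean_le_of_forall`): if `B ≤ D(ω)` for every torus limit of the canonical sector Gibbs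
states at `(β, t, s, U, n)` (any tori), then along every `Ls → ∞` and for every `ε > 0`, eventually
`(B − ε)·(Ls j)² ≤ Σ_i p_{Ls j,i} Re⟨ψ_i, H_{Ls j}(0,0,1) ψ_i⟩` (compactness of the thermal torus-limit class and
`tendsto_meanEnergy_hubbardTTPrime 0 0 1`).
[cite: BratteliRobinsonI1987, Thm. 2.3.15 (weak-⋆ compactness of the state space) and §4.3.1] -/
theorem eventually_le_sectorGibbs_doccMean_of_forall (hn0 : 0 ≤ n) (hn2 : n ≤ 2) {U B : ℝ}
    (hB : ∀ (ω : InfVolFermionState 2) (Ls : ℕ → ℕ), Tendsto Ls atTop atTop →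
      ω.IsTorusLimitOfMixture (sectorGibbsCount n) (fun L => sectorGibbsWeightTT' β t s U n L)
        (fun L => sectorGibbsVectorTT' t s U n L) Ls →
      B ≤ ω.meanEnergy (hubbardTTPrimeFermionInteraction 0 0 1) 1)
    {Ls : ℕ → ℕ} (hLs : Tendsto Ls atTop atTop) {ε : ℝ} (hε : 0 < ε) :
    ∀ᶠ j in atTop, (B - ε) * (Ls j : ℝ) ^ 2 ≤ ∑ i, sectorGibbsWeightTT' β t s U n (Ls j) i *
        (QuantumLattice.expect (hubbardTorusTT' (Ls j) 0 0 1) (sectorGibbsVectorTT' t s U n (Ls j) i)).re := by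
  by_contra hcon
  rw [Filter.not_eventually] at hcon
  obtain ⟨φ, hφ, hφP⟩ := Filter.extraction_of_frequently_atTop hcon
  have hLφ : Tendsto (Ls ∘ φ) atTop atTop := hLs.comp hφ.tendsto_atTop
  obtain ⟨φ', hφ', ω, hω⟩ := exists_isTorusLimitOfMixture_sectorGibbs β t s U hn0 hn2 hLφ
  have hLφφ : Tendsto ((Ls ∘ φ) ∘ φ') atTop atTop := hLφ.comp hφ'.tendsto_atTop
  have hlim := hω.tendsto_meanEnergy_hubbardTTPrime 0 0 1 hLφφ
  have hle : ω.meanEnergy (hubbardTTPrimeFermionInteraction 0 0 1) 1 ≤ B - ε := by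
    refine le_of_tendsto hlim ?_
    filter_upwards [hLφφ.eventually_ge_atTop 1] with j hj
    have hj' : 1 ≤ Ls (φ (φ' j)) := hj
    have hL1 : (0 : ℝ) < (Ls (φ (φ' j)) : ℝ) := by exact_mod_cast hj'
    have hL2 : (0 : ℝ) < (Ls (φ (φ' j)) : ℝ) ^ 2 := by positivity
    have hnot := hφP (φ' j)
    rw [not_le] at hnot
    have hsum : ∑ i, sectorGibbsWeightTT' β t s U n (Ls (φ (φ' j))) i *
        ((QuantumLattice.expect (hubbardTorusTT' (Ls (φ (φ' j))) 0 0 1)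
          (sectorGibbsVectorTT' t s U n (Ls (φ (φ' j))) i)).re / (Ls (φ (φ' j)) : ℝ) ^ 2) =
        (∑ i, sectorGibbsWeightTT' β t s U n (Ls (φ (φ' j))) i *
          (QuantumLattice.expect (hubbardTorusTT' (Ls (φ (φ' j))) 0 0 1)
            (sectorGibbsVectorTT' t s U n (Ls (φ (φ' j))) i)).re) / (Ls (φ (φ' j)) : ℝ) ^ 2 := by
      rw [Finset.sum_div]
      exact Finset.sum_congr rfl fun i _ => by ring
    show ∑ i, sectorGibbsWeightTT' β t s U n (Ls (φ (φ' j))) i *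
        ((QuantumLattice.expect (hubbardTorusTT' (Ls (φ (φ' j))) 0 0 1)
          (sectorGibbsVectorTT' t s U n (Ls (φ (φ' j))) i)).re / (Ls (φ (φ' j)) : ℝ) ^ 2) ≤ B - ε
    rw [hsum, div_le_iff₀ hL2]
    exact hnot.le
  have hω' := hB ω ((Ls ∘ φ) ∘ φ') hLφφ hω
  linarith

/-! ### §4 Word-priced and word-gaining single steps in the `hW` / `hu` shapes -/

/-- **A pressure FLOOR moves UP in `U` at the price of a certified thermal docc CEILING word** (`β > 0`,
`0 ≤ n ≤ 2`, `U₁ ≤ U₀ ≤ U`): if `A` is a docc-ceiling word at `(β, U₁)` (hence at the anchor `U₀`) and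
`∀ ε > 0, ∀ᶠ j, (W − ε)L² ≤ log Re Z_β(H(t,s,U₀)|_s)`, then
`∀ ε > 0, ∀ᶠ j, (W − β(U − U₀)·A − ε)L² ≤ log Re Z_β(H(t,s,U)|_s)` (lower Peierls–Bogoliubov tangent at the anchor, the
word made an eventual finite-volume slope by compactness; the exact price `β(U − U₀)A`).
[cite: Lieb1973, §V (5.2)–(5.4)] [cite: BratteliRobinsonI1987, Thm. 2.3.15 (weak-⋆ compactness of the state space) and §4.3.1] -/
theorem eventually_pressureFloor_of_doccWord_left_U (hn0 : 0 ≤ n) (hn2 : n ≤ 2) (hβ : 0 < β) {U₁ U₀ U : ℝ}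
    (hU₁ : U₁ ≤ U₀) (hU : U₀ ≤ U) {A : ℝ}
    (hA : ∀ (ω : InfVolFermionState 2) (Ls : ℕ → ℕ), Tendsto Ls atTop atTop →
      ω.IsTorusLimitOfMixture (sectorGibbsCount n) (fun L => sectorGibbsWeightTT' β t s U₁ n L)
        (fun L => sectorGibbsVectorTT' t s U₁ n L) Ls →
      ω.meanEnergy (hubbardTTPrimeFermionInteraction 0 0 1) 1 ≤ A)
    {Ls : ℕ → ℕ} (hLs : Tendsto Ls atTop atTop) {W : ℝ}
    (hW : ∀ ε : ℝ, 0 < ε → ∀ᶠ j in atTop,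
      (W - ε) * (Ls j : ℝ) ^ 2 ≤ Real.log (partitionFn β (sectorHamiltonianTT' t s U₀ n (Ls j))).re)
    {ε : ℝ} (hε : 0 < ε) :
    ∀ᶠ j in atTop, (W - β * (U - U₀) * A - ε) * (Ls j : ℝ) ^ 2 ≤
      Real.log (partitionFn β (sectorHamiltonianTT' t s U n (Ls j))).re := by
  have hAU : ∀ (ω : InfVolFermionState 2) (Ls' : ℕ → ℕ), Tendsto Ls' atTop atTop →
      ω.IsTorusLimitOfMixture (sectorGibbsCount n) (fun L => sectorGibbsWeightTT' β t s U₀ n L)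
        (fun L => sectorGibbsVectorTT' t s U₀ n L) Ls' →
      ω.meanEnergy (hubbardTTPrimeFermionInteraction 0 0 1) 1 ≤ A :=
    fun ω Ls' hLs' hω =>
      hω.meanEnergy_onSite_le_of_forall_left_U_of_sectorGibbs hn0 hn2 hβ hU₁ hA hLs'
  have hc : 0 ≤ β * (U - U₀) := mul_nonneg hβ.le (sub_nonneg.2 hU)
  set ε₂ : ℝ := ε / (2 * (β * (U - U₀) + 1)) with hε₂
  have hε₂pos : 0 < ε₂ := by positivity
  have hslack : β * (U - U₀) * ε₂ ≤ ε / 2 := by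
    have h1 : ε₂ * (2 * (β * (U - U₀) + 1)) = ε := by rw [hε₂]; field_simp
    nlinarith
  filter_upwards [hW (ε / 2) (by linarith), eventually_sectorGibbs_doccMean_le_of_forall hn0 hn2 hAU hLs hε₂pos,
    hLs.eventually_ge_atTop 1] with j hWj hm hL
  haveI : NeZero (Ls j) := ⟨by omega⟩
  have hL2 : (0 : ℝ) ≤ (Ls j : ℝ) ^ 2 := by positivity
  have hb := (log_partitionFn_sector_sub_mem_Icc_U hn0 hn2 (Ls j) t s β U₀ U).2
  have h2 := mul_le_mul_of_nonneg_left hm hc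
  have h3 := mul_le_mul_of_nonneg_right hslack hL2
  nlinarith [hb, h2, h3, hWj]

/-- The same in the `ℓ·L²` shape of the chords: eventually `ℓ·L² ≤ log Re Z_β(H(t,s,U₀)|_s)` and a docc-ceiling word
`A` at `(β, U₁)`, `U₁ ≤ U₀ ≤ U`, give for every `ε > 0` eventually
`(ℓ − β(U − U₀)(A + ε))·L² ≤ log Re Z_β(H(t,s,U)|_s)`. [cite: Lieb1973, §V (5.2)–(5.4)]
[cite: BratteliRobinsonI1987, Thm. 2.3.15 (weak-⋆ compactness of the state space) and §4.3.1] -/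
theorem eventually_mul_sq_le_log_partitionFn_sector_of_doccWord_left_U (hn0 : 0 ≤ n) (hn2 : n ≤ 2)
    (hβ : 0 < β) {U₁ U₀ U : ℝ} (hU₁ : U₁ ≤ U₀) (hU : U₀ ≤ U) {A : ℝ}
    (hA : ∀ (ω : InfVolFermionState 2) (Ls : ℕ → ℕ), Tendsto Ls atTop atTop →
      ω.IsTorusLimitOfMixture (sectorGibbsCount n) (fun L => sectorGibbsWeightTT' β t s U₁ n L)
        (fun L => sectorGibbsVectorTT' t s U₁ n L) Ls →
      ω.meanEnergy (hubbardTTPrimeFermionInteraction 0 0 1) 1 ≤ A)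
    {Ls : ℕ → ℕ} (hLs : Tendsto Ls atTop atTop) {ℓ : ℝ}
    (hℓ : ∀ᶠ j in atTop, ℓ * (Ls j : ℝ) ^ 2 ≤
      Real.log (partitionFn β (sectorHamiltonianTT' t s U₀ n (Ls j))).re)
    {ε : ℝ} (hε : 0 < ε) :
    ∀ᶠ j in atTop, (ℓ - β * (U - U₀) * (A + ε)) * (Ls j : ℝ) ^ 2 ≤
      Real.log (partitionFn β (sectorHamiltonianTT' t s U n (Ls j))).re := by
  have hAU : ∀ (ω : InfVolFermionState 2) (Ls' : ℕ → ℕ), Tendsto Ls' atTop atTop →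
      ω.IsTorusLimitOfMixture (sectorGibbsCount n) (fun L => sectorGibbsWeightTT' β t s U₀ n L)
        (fun L => sectorGibbsVectorTT' t s U₀ n L) Ls' →
      ω.meanEnergy (hubbardTTPrimeFermionInteraction 0 0 1) 1 ≤ A :=
    fun ω Ls' hLs' hω =>
      hω.meanEnergy_onSite_le_of_forall_left_U_of_sectorGibbs hn0 hn2 hβ hU₁ hA hLs'
  have hc : 0 ≤ β * (U - U₀) := mul_nonneg hβ.le (sub_nonneg.2 hU)
  filter_upwards [hℓ, eventually_sectorGibbs_doccMean_le_of_forall hn0 hn2 hAU hLs hε,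
    hLs.eventually_ge_atTop 1] with j hj hm hL
  haveI : NeZero (Ls j) := ⟨by omega⟩
  have hb := (log_partitionFn_sector_sub_mem_Icc_U hn0 hn2 (Ls j) t s β U₀ U).2
  have h2 := mul_le_mul_of_nonneg_left hm hc
  nlinarith [hb, h2, hj]

/-- **A pressure FLOOR moves DOWN in `U` GAINING a certified thermal docc FLOOR word** (`β > 0`, `0 ≤ n ≤ 2`,
`U ≤ U₀ ≤ U₂`): if `B ≤ D(ω)` for every thermal torus limit at `(β, U₂)` (hence at the anchor `U₀`) and
`∀ ε > 0, ∀ᶠ j, (W − ε)L² ≤ log Re Z_β(H(t,s,U₀)|_s)`, then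
`∀ ε > 0, ∀ᶠ j, (W + β(U₀ − U)·B − ε)L² ≤ log Re Z_β(H(t,s,U)|_s)` (the free move is `B = 0`).
[cite: Lieb1973, §V (5.2)–(5.4)] [cite: BratteliRobinsonI1987, Thm. 2.3.15 (weak-⋆ compactness of the state space) and §4.3.1] -/
theorem eventually_pressureFloor_of_doccFloorWord_right_U (hn0 : 0 ≤ n) (hn2 : n ≤ 2) (hβ : 0 < β)
    {U U₀ U₂ : ℝ} (hU : U ≤ U₀) (hU₂ : U₀ ≤ U₂) {B : ℝ}
    (hB : ∀ (ω : InfVolFermionState 2) (Ls : ℕ → ℕ), Tendsto Ls atTop atTop →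
      ω.IsTorusLimitOfMixture (sectorGibbsCount n) (fun L => sectorGibbsWeightTT' β t s U₂ n L)
        (fun L => sectorGibbsVectorTT' t s U₂ n L) Ls →
      B ≤ ω.meanEnergy (hubbardTTPrimeFermionInteraction 0 0 1) 1)
    {Ls : ℕ → ℕ} (hLs : Tendsto Ls atTop atTop) {W : ℝ}
    (hW : ∀ ε : ℝ, 0 < ε → ∀ᶠ j in atTop,
      (W - ε) * (Ls j : ℝ) ^ 2 ≤ Real.log (partitionFn β (sectorHamiltonianTT' t s U₀ n (Ls j))).re)
    {ε : ℝ} (hε : 0 < ε) :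
    ∀ᶠ j in atTop, (W + β * (U₀ - U) * B - ε) * (Ls j : ℝ) ^ 2 ≤
      Real.log (partitionFn β (sectorHamiltonianTT' t s U n (Ls j))).re := by
  have hBU : ∀ (ω : InfVolFermionState 2) (Ls' : ℕ → ℕ), Tendsto Ls' atTop atTop →
      ω.IsTorusLimitOfMixture (sectorGibbsCount n) (fun L => sectorGibbsWeightTT' β t s U₀ n L)
        (fun L => sectorGibbsVectorTT' t s U₀ n L) Ls' →
      B ≤ ω.meanEnergy (hubbardTTPrimeFermionInteraction 0 0 1) 1 :=
    fun ω Ls' hLs' hω =>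
      hω.le_meanEnergy_onSite_of_forall_right_U_of_sectorGibbs hn0 hn2 hβ hU₂ hB hLs'
  have hc : 0 ≤ β * (U₀ - U) := mul_nonneg hβ.le (sub_nonneg.2 hU)
  set ε₂ : ℝ := ε / (2 * (β * (U₀ - U) + 1)) with hε₂
  have hε₂pos : 0 < ε₂ := by positivity
  have hslack : β * (U₀ - U) * ε₂ ≤ ε / 2 := by
    have h1 : ε₂ * (2 * (β * (U₀ - U) + 1)) = ε := by rw [hε₂]; field_simp
    nlinarith
  filter_upwards [hW (ε / 2) (by linarith), eventually_le_sectorGibbs_doccMean_of_forall hn0 hn2 hBU hLs hε₂pos,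
    hLs.eventually_ge_atTop 1] with j hWj hm hL
  haveI : NeZero (Ls j) := ⟨by omega⟩
  have hL2 : (0 : ℝ) ≤ (Ls j : ℝ) ^ 2 := by positivity
  have hb := (log_partitionFn_sector_sub_mem_Icc_U hn0 hn2 (Ls j) t s β U U₀).1
  have h2 := mul_le_mul_of_nonneg_left hm hc
  have h3 := mul_le_mul_of_nonneg_right hslack hL2
  nlinarith [hb, h2, h3, hWj]

/-- **A pressure CEILING moves UP in `U` GAINING a certified thermal docc FLOOR word** (`β > 0`, `0 ≤ n ≤ 2`,
`U₀ ≤ U ≤ U₂`): if `B ≤ D(ω)` for every thermal torus limit at `(β, U₂)` (hence at the target `U`) and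
`∀ ε > 0, ∀ᶠ j, log Re Z_β(H(t,s,U₀)|_s) ≤ (u + ε)L²`, then
`∀ ε > 0, ∀ᶠ j, log Re Z_β(H(t,s,U)|_s) ≤ (u − β(U − U₀)·B + ε)L²` (the free move is `B = 0`).
[cite: Lieb1973, §V (5.2)–(5.4)] [cite: BratteliRobinsonI1987, Thm. 2.3.15 (weak-⋆ compactness of the state space) and §4.3.1] -/
theorem eventually_pressureCeiling_of_doccFloorWord_right_U (hn0 : 0 ≤ n) (hn2 : n ≤ 2) (hβ : 0 < β)
    {U₀ U U₂ : ℝ} (hU : U₀ ≤ U) (hU₂ : U ≤ U₂) {B : ℝ}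
    (hB : ∀ (ω : InfVolFermionState 2) (Ls : ℕ → ℕ), Tendsto Ls atTop atTop →
      ω.IsTorusLimitOfMixture (sectorGibbsCount n) (fun L => sectorGibbsWeightTT' β t s U₂ n L)
        (fun L => sectorGibbsVectorTT' t s U₂ n L) Ls →
      B ≤ ω.meanEnergy (hubbardTTPrimeFermionInteraction 0 0 1) 1)
    {Ls : ℕ → ℕ} (hLs : Tendsto Ls atTop atTop) {u : ℝ}
    (hu : ∀ ε : ℝ, 0 < ε → ∀ᶠ j in atTop,
      Real.log (partitionFn β (sectorHamiltonianTT' t s U₀ n (Ls j))).re ≤ (u + ε) * (Ls j : ℝ) ^ 2)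
    {ε : ℝ} (hε : 0 < ε) :
    ∀ᶠ j in atTop, Real.log (partitionFn β (sectorHamiltonianTT' t s U n (Ls j))).re ≤
      (u - β * (U - U₀) * B + ε) * (Ls j : ℝ) ^ 2 := by
  have hBU : ∀ (ω : InfVolFermionState 2) (Ls' : ℕ → ℕ), Tendsto Ls' atTop atTop →
      ω.IsTorusLimitOfMixture (sectorGibbsCount n) (fun L => sectorGibbsWeightTT' β t s U n L)
        (fun L => sectorGibbsVectorTT' t s U n L) Ls' →
      B ≤ ω.meanEnergy (hubbardTTPrimeFermionInteraction 0 0 1) 1 :=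
    fun ω Ls' hLs' hω =>
      hω.le_meanEnergy_onSite_of_forall_right_U_of_sectorGibbs hn0 hn2 hβ hU₂ hB hLs'
  have hc : 0 ≤ β * (U - U₀) := mul_nonneg hβ.le (sub_nonneg.2 hU)
  set ε₂ : ℝ := ε / (2 * (β * (U - U₀) + 1)) with hε₂
  have hε₂pos : 0 < ε₂ := by positivity
  have hslack : β * (U - U₀) * ε₂ ≤ ε / 2 := by
    have h1 : ε₂ * (2 * (β * (U - U₀) + 1)) = ε := by rw [hε₂]; field_simp
    nlinarith
  filter_upwards [hu (ε / 2) (by linarith), eventually_le_sectorGibbs_doccMean_of_forall hn0 hn2 hBU hLs hε₂pos,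
    hLs.eventually_ge_atTop 1] with j huj hm hL
  haveI : NeZero (Ls j) := ⟨by omega⟩
  have hL2 : (0 : ℝ) ≤ (Ls j : ℝ) ^ 2 := by positivity
  have hb := (log_partitionFn_sector_sub_mem_Icc_U hn0 hn2 (Ls j) t s β U₀ U).1
  have h2 := mul_le_mul_of_nonneg_left hm hc
  have h3 := mul_le_mul_of_nonneg_right hslack hL2
  nlinarith [hb, h2, h3, huj]

/-- **A pressure CEILING moves DOWN in `U` at the price of a certified thermal docc CEILING word**, `hu` shape
(`β > 0`, `0 ≤ n ≤ 2`, `U₁ ≤ U ≤ U₀`; the `ε`-form of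
`eventually_log_partitionFn_sectorHamiltonianTT'_le_of_doccWord_left_U`): a docc-ceiling word `A` at `(β, U₁)` and
`∀ ε > 0, ∀ᶠ j, log Re Z_β(H(t,s,U₀)|_s) ≤ (u + ε)L²` give
`∀ ε > 0, ∀ᶠ j, log Re Z_β(H(t,s,U)|_s) ≤ (u + β(U₀ − U)·A + ε)L²`.
[cite: Lieb1973, §V (5.2)–(5.4)] [cite: BratteliRobinsonI1987, Thm. 2.3.15 (weak-⋆ compactness of the state space) and §4.3.1] -/
theorem eventually_pressureCeiling_of_doccWord_left_U (hn0 : 0 ≤ n) (hn2 : n ≤ 2) (hβ : 0 < β)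
    {U₁ U U₀ : ℝ} (hU₁ : U₁ ≤ U) (hU : U ≤ U₀) {A : ℝ}
    (hA : ∀ (ω : InfVolFermionState 2) (Ls : ℕ → ℕ), Tendsto Ls atTop atTop →
      ω.IsTorusLimitOfMixture (sectorGibbsCount n) (fun L => sectorGibbsWeightTT' β t s U₁ n L)
        (fun L => sectorGibbsVectorTT' t s U₁ n L) Ls →
      ω.meanEnergy (hubbardTTPrimeFermionInteraction 0 0 1) 1 ≤ A)
    {Ls : ℕ → ℕ} (hLs : Tendsto Ls atTop atTop) {u : ℝ}
    (hu : ∀ ε : ℝ, 0 < ε → ∀ᶠ j in atTop,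
      Real.log (partitionFn β (sectorHamiltonianTT' t s U₀ n (Ls j))).re ≤ (u + ε) * (Ls j : ℝ) ^ 2)
    {ε : ℝ} (hε : 0 < ε) :
    ∀ᶠ j in atTop, Real.log (partitionFn β (sectorHamiltonianTT' t s U n (Ls j))).re ≤
      (u + β * (U₀ - U) * A + ε) * (Ls j : ℝ) ^ 2 := by
  have hc : 0 ≤ β * (U₀ - U) := mul_nonneg hβ.le (sub_nonneg.2 hU)
  set ε₂ : ℝ := ε / (2 * (β * (U₀ - U) + 1)) with hε₂
  have hε₂pos : 0 < ε₂ := by positivity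
  have hslack : β * (U₀ - U) * ε₂ ≤ ε / 2 := by
    have h1 : ε₂ * (2 * (β * (U₀ - U) + 1)) = ε := by rw [hε₂]; field_simp
    nlinarith
  have hu' : ∀ᶠ j in atTop, Real.log (partitionFn β (sectorHamiltonianTT' t s U₀ n (Ls j))).re ≤
      (u + ε / 2) * (Ls j : ℝ) ^ 2 + 0 := (hu (ε / 2) (by linarith)).mono fun j hj => by rw [add_zero]; exact hj
  have h := eventually_log_partitionFn_sectorHamiltonianTT'_le_of_doccWord_left_U hn0 hn2 hβ hU₁ hU hA hLs hu'
    hε₂pos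
  filter_upwards [h] with j hj
  have hL2 : (0 : ℝ) ≤ (Ls j : ℝ) ^ 2 := by positivity
  have h3 := mul_le_mul_of_nonneg_right hslack hL2
  nlinarith [hj, h3]

/-! ### §5 The `U`-staircases in the thermodynamic limit -/

/-- **`U`-staircase pressure FLOOR, moving to LARGER `U`** (`0 ≤ n ≤ 2`, `β ≥ 0`, `Ls → ∞`): a monotone grid
`u : ℕ → ℝ`, `N` steps, a pressure floor `W₀` at `u 0` along `Ls` (`hW` shape) and, for every `i < N`, a thermal
docc CEILING word `A i` at `(β, u i)`. Then along `Ls`, for every `ε > 0`, eventually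
`(W₀ − β Σ_{i<N} (u_{i+1} − u_i)·A_i − ε)(Ls j)² ≤ log Re Z_β(H(t,s,u_N)|_s)` — the Riemann-sum form of
`π(U_N) = π(U₀) − β ∫ ⟨D⟩ dU` with `⟨D⟩` antitone in `U`. [cite: GustafsonSigal2003, §18.3]
[cite: Lieb1973, §V (5.2)–(5.4)] -/
theorem eventually_pressureFloor_staircase_U (hn0 : 0 ≤ n) (hn2 : n ≤ 2) (hβ : 0 ≤ β) {Ls : ℕ → ℕ}
    (hLs : Tendsto Ls atTop atTop) {u : ℕ → ℝ} (hu : Monotone u) (N : ℕ) {A : ℕ → ℝ}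
    (hA : ∀ i < N, ∀ (ω : InfVolFermionState 2) (Ls' : ℕ → ℕ), Tendsto Ls' atTop atTop →
      ω.IsTorusLimitOfMixture (sectorGibbsCount n) (fun L => sectorGibbsWeightTT' β t s (u i) n L)
        (fun L => sectorGibbsVectorTT' t s (u i) n L) Ls' →
      ω.meanEnergy (hubbardTTPrimeFermionInteraction 0 0 1) 1 ≤ A i)
    {W₀ : ℝ}
    (hW₀ : ∀ ε : ℝ, 0 < ε → ∀ᶠ j in atTop,
      (W₀ - ε) * (Ls j : ℝ) ^ 2 ≤ Real.log (partitionFn β (sectorHamiltonianTT' t s (u 0) n (Ls j))).re)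
    {ε : ℝ} (hε : 0 < ε) :
    ∀ᶠ j in atTop, (W₀ - β * ∑ i ∈ Finset.range N, (u (i + 1) - u i) * A i - ε) * (Ls j : ℝ) ^ 2 ≤
      Real.log (partitionFn β (sectorHamiltonianTT' t s (u N) n (Ls j))).re := by
  set D : ℝ := ∑ i ∈ Finset.range N, (u (i + 1) - u i) with hD
  have hD0 : 0 ≤ D := Finset.sum_nonneg fun i _ => sub_nonneg.2 (hu (Nat.le_succ i))
  have hβD : 0 ≤ β * D := mul_nonneg hβ hD0
  set ε₂ : ℝ := ε / (2 * (β * D + 1)) with hε₂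
  have hε₂pos : 0 < ε₂ := by positivity
  have hslack : β * (ε₂ * D) ≤ ε / 2 := by
    have h1 : ε₂ * (2 * (β * D + 1)) = ε := by rw [hε₂]; field_simp
    nlinarith
  have hcaps : ∀ᶠ j in atTop, ∀ i ∈ Finset.range N,
      ∑ k, sectorGibbsWeightTT' β t s (u i) n (Ls j) k *
          (QuantumLattice.expect (hubbardTorusTT' (Ls j) 0 0 1) (sectorGibbsVectorTT' t s (u i) n (Ls j) k)).re ≤
        (A i + ε₂) * (Ls j : ℝ) ^ 2 := by
    rw [eventually_all_finset]
    intro i hi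
    exact eventually_sectorGibbs_doccMean_le_of_forall hn0 hn2 (hA i (Finset.mem_range.1 hi)) hLs hε₂pos
  filter_upwards [hcaps, hW₀ (ε / 2) (by linarith), hLs.eventually_ge_atTop 1] with j hj hWj hj1
  haveI : NeZero (Ls j) := ⟨by omega⟩
  have hL2 : (0 : ℝ) ≤ (Ls j : ℝ) ^ 2 := by positivity
  have hst := log_partitionFn_sector_sub_le_sum_U hn0 hn2 (Ls j) t s hβ hu N
    (M := fun i => (A i + ε₂) * (Ls j : ℝ) ^ 2) (fun i hi => hj i (Finset.mem_range.2 hi))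
  have hsum : ∑ i ∈ Finset.range N, (u (i + 1) - u i) * ((A i + ε₂) * (Ls j : ℝ) ^ 2) =
      (∑ i ∈ Finset.range N, (u (i + 1) - u i) * A i) * (Ls j : ℝ) ^ 2 + ε₂ * D * (Ls j : ℝ) ^ 2 := by
    rw [hD, Finset.sum_mul, Finset.mul_sum, Finset.sum_mul, ← Finset.sum_add_distrib]
    refine Finset.sum_congr rfl fun i _ => ?_
    ring
  rw [hsum] at hst
  have h3 : β * (ε₂ * D) * (Ls j : ℝ) ^ 2 ≤ ε / 2 * (Ls j : ℝ) ^ 2 := mul_le_mul_of_nonneg_right hslack hL2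
  nlinarith [hst, hWj, h3]

/-- **`U`-staircase pressure CEILING, moving to SMALLER `U`** (`0 ≤ n ≤ 2`, `β ≥ 0`, `Ls → ∞`): a monotone grid
`u`, `N` steps, a pressure ceiling `u⁺` at `u N` along `Ls` (`hu` shape) and docc CEILING words `A i` at `(β, u i)`
for `i < N`. Then along `Ls`, for every `ε > 0`, eventually
`log Re Z_β(H(t,s,u_0)|_s) ≤ (u⁺ + β Σ_{i<N} (u_{i+1} − u_i)·A_i + ε)(Ls j)²` (the multi-step form of the word-priced
downward move of a hot cap). [cite: GustafsonSigal2003, §18.3] [cite: Lieb1973, §V (5.2)–(5.4)] -/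
theorem eventually_pressureCeiling_staircase_U_down (hn0 : 0 ≤ n) (hn2 : n ≤ 2) (hβ : 0 ≤ β) {Ls : ℕ → ℕ}
    (hLs : Tendsto Ls atTop atTop) {u : ℕ → ℝ} (hu : Monotone u) (N : ℕ) {A : ℕ → ℝ}
    (hA : ∀ i < N, ∀ (ω : InfVolFermionState 2) (Ls' : ℕ → ℕ), Tendsto Ls' atTop atTop →
      ω.IsTorusLimitOfMixture (sectorGibbsCount n) (fun L => sectorGibbsWeightTT' β t s (u i) n L)
        (fun L => sectorGibbsVectorTT' t s (u i) n L) Ls' →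
      ω.meanEnergy (hubbardTTPrimeFermionInteraction 0 0 1) 1 ≤ A i)
    {up : ℝ}
    (hup : ∀ ε : ℝ, 0 < ε → ∀ᶠ j in atTop,
      Real.log (partitionFn β (sectorHamiltonianTT' t s (u N) n (Ls j))).re ≤ (up + ε) * (Ls j : ℝ) ^ 2)
    {ε : ℝ} (hε : 0 < ε) :
    ∀ᶠ j in atTop, Real.log (partitionFn β (sectorHamiltonianTT' t s (u 0) n (Ls j))).re ≤
      (up + β * ∑ i ∈ Finset.range N, (u (i + 1) - u i) * A i + ε) * (Ls j : ℝ) ^ 2 := by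
  set D : ℝ := ∑ i ∈ Finset.range N, (u (i + 1) - u i) with hD
  have hD0 : 0 ≤ D := Finset.sum_nonneg fun i _ => sub_nonneg.2 (hu (Nat.le_succ i))
  have hβD : 0 ≤ β * D := mul_nonneg hβ hD0
  set ε₂ : ℝ := ε / (2 * (β * D + 1)) with hε₂
  have hε₂pos : 0 < ε₂ := by positivity
  have hslack : β * (ε₂ * D) ≤ ε / 2 := by
    have h1 : ε₂ * (2 * (β * D + 1)) = ε := by rw [hε₂]; field_simp
    nlinarith
  have hcaps : ∀ᶠ j in atTop, ∀ i ∈ Finset.range N,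
      ∑ k, sectorGibbsWeightTT' β t s (u i) n (Ls j) k *
          (QuantumLattice.expect (hubbardTorusTT' (Ls j) 0 0 1) (sectorGibbsVectorTT' t s (u i) n (Ls j) k)).re ≤
        (A i + ε₂) * (Ls j : ℝ) ^ 2 := by
    rw [eventually_all_finset]
    intro i hi
    exact eventually_sectorGibbs_doccMean_le_of_forall hn0 hn2 (hA i (Finset.mem_range.1 hi)) hLs hε₂pos
  filter_upwards [hcaps, hup (ε / 2) (by linarith), hLs.eventually_ge_atTop 1] with j hj huj hj1
  haveI : NeZero (Ls j) := ⟨by omega⟩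
  have hL2 : (0 : ℝ) ≤ (Ls j : ℝ) ^ 2 := by positivity
  have hst := log_partitionFn_sector_sub_le_sum_U hn0 hn2 (Ls j) t s hβ hu N
    (M := fun i => (A i + ε₂) * (Ls j : ℝ) ^ 2) (fun i hi => hj i (Finset.mem_range.2 hi))
  have hsum : ∑ i ∈ Finset.range N, (u (i + 1) - u i) * ((A i + ε₂) * (Ls j : ℝ) ^ 2) =
      (∑ i ∈ Finset.range N, (u (i + 1) - u i) * A i) * (Ls j : ℝ) ^ 2 + ε₂ * D * (Ls j : ℝ) ^ 2 := by
    rw [hD, Finset.sum_mul, Finset.mul_sum, Finset.sum_mul, ← Finset.sum_add_distrib]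
    refine Finset.sum_congr rfl fun i _ => ?_
    ring
  rw [hsum] at hst
  have h3 : β * (ε₂ * D) * (Ls j : ℝ) ^ 2 ≤ ε / 2 * (Ls j : ℝ) ^ 2 := mul_le_mul_of_nonneg_right hslack hL2
  nlinarith [hst, huj, h3]

/-- **`U`-staircase pressure CEILING, moving to LARGER `U`, gaining docc FLOOR words** (`0 ≤ n ≤ 2`, `β ≥ 0`):
a pressure ceiling `u⁺` at `u 0` (`hu` shape) and docc FLOOR words `B (i+1)` at `(β, u (i+1))` for `i < N` give, along
`Ls`, for every `ε > 0`, eventually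
`log Re Z_β(H(t,s,u_N)|_s) ≤ (u⁺ − β Σ_{i<N} (u_{i+1} − u_i)·B_{i+1} + ε)(Ls j)²` (the free move is `B = 0`).
[cite: GustafsonSigal2003, §18.3] [cite: Lieb1973, §V (5.2)–(5.4)] -/
theorem eventually_pressureCeiling_staircase_U (hn0 : 0 ≤ n) (hn2 : n ≤ 2) (hβ : 0 ≤ β) {Ls : ℕ → ℕ}
    (hLs : Tendsto Ls atTop atTop) {u : ℕ → ℝ} (hu : Monotone u) (N : ℕ) {B : ℕ → ℝ}
    (hB : ∀ i < N, ∀ (ω : InfVolFermionState 2) (Ls' : ℕ → ℕ), Tendsto Ls' atTop atTop →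
      ω.IsTorusLimitOfMixture (sectorGibbsCount n) (fun L => sectorGibbsWeightTT' β t s (u (i + 1)) n L)
        (fun L => sectorGibbsVectorTT' t s (u (i + 1)) n L) Ls' →
      B (i + 1) ≤ ω.meanEnergy (hubbardTTPrimeFermionInteraction 0 0 1) 1)
    {up : ℝ}
    (hup : ∀ ε : ℝ, 0 < ε → ∀ᶠ j in atTop,
      Real.log (partitionFn β (sectorHamiltonianTT' t s (u 0) n (Ls j))).re ≤ (up + ε) * (Ls j : ℝ) ^ 2)
    {ε : ℝ} (hε : 0 < ε) :
    ∀ᶠ j in atTop, Real.log (partitionFn β (sectorHamiltonianTT' t s (u N) n (Ls j))).re ≤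
      (up - β * ∑ i ∈ Finset.range N, (u (i + 1) - u i) * B (i + 1) + ε) * (Ls j : ℝ) ^ 2 := by
  set D : ℝ := ∑ i ∈ Finset.range N, (u (i + 1) - u i) with hD
  have hD0 : 0 ≤ D := Finset.sum_nonneg fun i _ => sub_nonneg.2 (hu (Nat.le_succ i))
  have hβD : 0 ≤ β * D := mul_nonneg hβ hD0
  set ε₂ : ℝ := ε / (2 * (β * D + 1)) with hε₂
  have hε₂pos : 0 < ε₂ := by positivity
  have hslack : β * (ε₂ * D) ≤ ε / 2 := by
    have h1 : ε₂ * (2 * (β * D + 1)) = ε := by rw [hε₂]; field_simp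
    nlinarith
  have hfloors : ∀ᶠ j in atTop, ∀ i ∈ Finset.range N,
      (B (i + 1) - ε₂) * (Ls j : ℝ) ^ 2 ≤ ∑ k, sectorGibbsWeightTT' β t s (u (i + 1)) n (Ls j) k *
          (QuantumLattice.expect (hubbardTorusTT' (Ls j) 0 0 1)
            (sectorGibbsVectorTT' t s (u (i + 1)) n (Ls j) k)).re := by
    rw [eventually_all_finset]
    intro i hi
    exact eventually_le_sectorGibbs_doccMean_of_forall hn0 hn2 (hB i (Finset.mem_range.1 hi)) hLs hε₂pos
  filter_upwards [hfloors, hup (ε / 2) (by linarith), hLs.eventually_ge_atTop 1] with j hj huj hj1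
  haveI : NeZero (Ls j) := ⟨by omega⟩
  have hL2 : (0 : ℝ) ≤ (Ls j : ℝ) ^ 2 := by positivity
  have hst := sum_le_log_partitionFn_sector_sub_U hn0 hn2 (Ls j) t s hβ hu N
    (M' := fun i => (B i - ε₂) * (Ls j : ℝ) ^ 2) (fun i hi => hj i (Finset.mem_range.2 hi))
  have hsum : ∑ i ∈ Finset.range N, (u (i + 1) - u i) * ((B (i + 1) - ε₂) * (Ls j : ℝ) ^ 2) =
      (∑ i ∈ Finset.range N, (u (i + 1) - u i) * B (i + 1)) * (Ls j : ℝ) ^ 2 - ε₂ * D * (Ls j : ℝ) ^ 2 := by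
    rw [hD, Finset.sum_mul, Finset.mul_sum, Finset.sum_mul, ← Finset.sum_sub_distrib]
    refine Finset.sum_congr rfl fun i _ => ?_
    ring
  rw [hsum] at hst
  have h3 : β * (ε₂ * D) * (Ls j : ℝ) ^ 2 ≤ ε / 2 * (Ls j : ℝ) ^ 2 := mul_le_mul_of_nonneg_right hslack hL2
  nlinarith [hst, huj, h3]

/-- **`U`-staircase pressure FLOOR, moving to SMALLER `U`, gaining docc FLOOR words** (`0 ≤ n ≤ 2`, `β ≥ 0`):
a pressure floor `W` at `u N` (`hW` shape) and docc FLOOR words `B (i+1)` at `(β, u (i+1))` for `i < N` give, along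
`Ls`, for every `ε > 0`, eventually
`(W + β Σ_{i<N} (u_{i+1} − u_i)·B_{i+1} − ε)(Ls j)² ≤ log Re Z_β(H(t,s,u_0)|_s)` (the free move is `B = 0`).
[cite: GustafsonSigal2003, §18.3] [cite: Lieb1973, §V (5.2)–(5.4)] -/
theorem eventually_pressureFloor_staircase_U_down (hn0 : 0 ≤ n) (hn2 : n ≤ 2) (hβ : 0 ≤ β) {Ls : ℕ → ℕ}
    (hLs : Tendsto Ls atTop atTop) {u : ℕ → ℝ} (hu : Monotone u) (N : ℕ) {B : ℕ → ℝ}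
    (hB : ∀ i < N, ∀ (ω : InfVolFermionState 2) (Ls' : ℕ → ℕ), Tendsto Ls' atTop atTop →
      ω.IsTorusLimitOfMixture (sectorGibbsCount n) (fun L => sectorGibbsWeightTT' β t s (u (i + 1)) n L)
        (fun L => sectorGibbsVectorTT' t s (u (i + 1)) n L) Ls' →
      B (i + 1) ≤ ω.meanEnergy (hubbardTTPrimeFermionInteraction 0 0 1) 1)
    {W : ℝ}
    (hW : ∀ ε : ℝ, 0 < ε → ∀ᶠ j in atTop,
      (W - ε) * (Ls j : ℝ) ^ 2 ≤ Real.log (partitionFn β (sectorHamiltonianTT' t s (u N) n (Ls j))).re)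
    {ε : ℝ} (hε : 0 < ε) :
    ∀ᶠ j in atTop, (W + β * ∑ i ∈ Finset.range N, (u (i + 1) - u i) * B (i + 1) - ε) * (Ls j : ℝ) ^ 2 ≤
      Real.log (partitionFn β (sectorHamiltonianTT' t s (u 0) n (Ls j))).re := by
  set D : ℝ := ∑ i ∈ Finset.range N, (u (i + 1) - u i) with hD
  have hD0 : 0 ≤ D := Finset.sum_nonneg fun i _ => sub_nonneg.2 (hu (Nat.le_succ i))
  have hβD : 0 ≤ β * D := mul_nonneg hβ hD0
  set ε₂ : ℝ := ε / (2 * (β * D + 1)) with hε₂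
  have hε₂pos : 0 < ε₂ := by positivity
  have hslack : β * (ε₂ * D) ≤ ε / 2 := by
    have h1 : ε₂ * (2 * (β * D + 1)) = ε := by rw [hε₂]; field_simp
    nlinarith
  have hfloors : ∀ᶠ j in atTop, ∀ i ∈ Finset.range N,
      (B (i + 1) - ε₂) * (Ls j : ℝ) ^ 2 ≤ ∑ k, sectorGibbsWeightTT' β t s (u (i + 1)) n (Ls j) k *
          (QuantumLattice.expect (hubbardTorusTT' (Ls j) 0 0 1)
            (sectorGibbsVectorTT' t s (u (i + 1)) n (Ls j) k)).re := by
    rw [eventually_all_finset]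
    intro i hi
    exact eventually_le_sectorGibbs_doccMean_of_forall hn0 hn2 (hB i (Finset.mem_range.1 hi)) hLs hε₂pos
  filter_upwards [hfloors, hW (ε / 2) (by linarith), hLs.eventually_ge_atTop 1] with j hj hWj hj1
  haveI : NeZero (Ls j) := ⟨by omega⟩
  have hL2 : (0 : ℝ) ≤ (Ls j : ℝ) ^ 2 := by positivity
  have hst := sum_le_log_partitionFn_sector_sub_U hn0 hn2 (Ls j) t s hβ hu N
    (M' := fun i => (B i - ε₂) * (Ls j : ℝ) ^ 2) (fun i hi => hj i (Finset.mem_range.2 hi))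
  have hsum : ∑ i ∈ Finset.range N, (u (i + 1) - u i) * ((B (i + 1) - ε₂) * (Ls j : ℝ) ^ 2) =
      (∑ i ∈ Finset.range N, (u (i + 1) - u i) * B (i + 1)) * (Ls j : ℝ) ^ 2 - ε₂ * D * (Ls j : ℝ) ^ 2 := by
    rw [hD, Finset.sum_mul, Finset.mul_sum, Finset.sum_mul, ← Finset.sum_sub_distrib]
    refine Finset.sum_congr rfl fun i _ => ?_
    ring
  rw [hsum] at hst
  have h3 : β * (ε₂ * D) * (Ls j : ℝ) ^ 2 ≤ ε / 2 * (Ls j : ℝ) ^ 2 := mul_le_mul_of_nonneg_right hslack hL2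
  nlinarith [hst, hWj, h3]

end Words

/-! ### §6 Compositions: the C2 type class from ONE anchor `U`; the cross-corner `U`-cell energy windows -/

section Compositions

variable {t t' U n β : ℝ} {ω : InfVolFermionState 2} {Ls : ℕ → ℕ}

/-- The type density is nonnegative: `n · (q a b) = 2 A₀` with `q, a, b ≥ 1` forces `0 ≤ n`.
[cite: CoverThomas2006, Theorem 11.1.3] -/
theorem density_nonneg_of_type {a b q A₀ : ℕ} (ha : 1 ≤ a) (hb : 1 ≤ b) (hq : 1 ≤ q)
    (hn : n * ((q : ℝ) * a * b) = 2 * A₀) : 0 ≤ n := by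
  have hq' : (1 : ℝ) ≤ q := by exact_mod_cast hq
  have ha' : (1 : ℝ) ≤ a := by exact_mod_cast ha
  have hb' : (1 : ℝ) ≤ b := by exact_mod_cast hb
  have hqab : (0 : ℝ) < (q : ℝ) * a * b := by positivity
  have hA : (0 : ℝ) ≤ 2 * (A₀ : ℝ) := by positivity
  by_contra hneg
  rw [not_le] at hneg
  have : n * ((q : ℝ) * a * b) < 0 := mul_neg_of_neg_of_pos hneg hqab
  linarith

/-- **The C2 type-class pressure floor certified at ONE anchor `U₀` is an `hW` input at EVERY `U`** (kinematic
price; all tori): with the data of `eventually_typeFreeEntropy_mul_sq_le_log_partitionFn_allTori` at `(t, t', U₀)`,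
`W = (q log q − Σ m_s log m_s + Σ m_s log z_s)/(q a b)`, for every `U`, every `Ls → ∞` and every `ε > 0`, eventually
`(W − β·max(U − U₀, 0)·n/2 − ε)(Ls j)² ≤ log Re Z_β(H_{Ls j}(t,t',U)|_s)`.
[cite: Ruelle1969, §3.3] [cite: Lieb1973, §V (5.2)–(5.4)] [cite: Israel1979, Thm. I.3.4] -/
theorem eventually_typeFreeEntropy_mul_sq_le_log_partitionFn_allTori_of_anchorU_kinematic (t t' U₀ U n : ℝ)
    {β : ℝ} (hβ : 0 ≤ β) {a b : ℕ} (ha : 1 ≤ a) (hb : 1 ≤ b) (S : Finset (ℕ × ℕ)) (m : ℕ × ℕ → ℕ) {q A₀ : ℕ}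
    (hq : 1 ≤ q) (hmS : ∀ s, m s ≠ 0 → s ∈ S) (hsum : ∑ s ∈ S, m s = q) (hA : ∑ s ∈ S, m s * s.1 = A₀)
    (hB : ∑ s ∈ S, m s * s.2 = A₀) (hn : n * ((q : ℝ) * a * b) = 2 * A₀) (hn2 : n ≤ 2)
    {z : ℕ × ℕ → ℝ} (hz0 : ∀ s ∈ S, 0 < z s)
    (hz : ∀ s ∈ S, z s ≤ (partitionFn β (spinSectorHamiltonian s.1 s.2 (hubbardOpenBoxTT' a b t t' U₀))).re)
    {Ls : ℕ → ℕ} (hLs : Tendsto Ls atTop atTop) {ε : ℝ} (hε : 0 < ε) :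
    ∀ᶠ j in atTop, (((q : ℝ) * Real.log q - ∑ s ∈ S, (m s : ℝ) * Real.log (m s) +
        ∑ s ∈ S, (m s : ℝ) * Real.log (z s)) / ((q : ℝ) * a * b) - β * max (U - U₀) 0 * (n / 2) - ε) *
          (Ls j : ℝ) ^ 2 ≤
      Real.log (partitionFn β (sectorHamiltonianTT' t t' U n (Ls j))).re :=
  eventually_pressureFloor_of_anchorU_kinematic (density_nonneg_of_type ha hb hq hn) hn2 t t' hβ U₀ U hLs
    (fun _ hδ => eventually_typeFreeEntropy_mul_sq_le_log_partitionFn_allTori t t' U₀ n hβ ha hb S m hq hmS hsum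
      hA hB hn hn2 hz0 hz hLs hδ) hε

/-- **… and at every `U ≤ U₀` at NO price**: the C2 floor `W` certified at `U₀` is the `hW` input `W` at every
`U ≤ U₀`, every `Ls → ∞`. [cite: Ruelle1969, §3.3] [cite: Israel1979, Thm. I.3.4] -/
theorem eventually_typeFreeEntropy_mul_sq_le_log_partitionFn_allTori_of_le_U (t t' n : ℝ) {U U₀ : ℝ}
    (hU : U ≤ U₀) {β : ℝ} (hβ : 0 ≤ β) {a b : ℕ} (ha : 1 ≤ a) (hb : 1 ≤ b) (S : Finset (ℕ × ℕ))
    (m : ℕ × ℕ → ℕ) {q A₀ : ℕ} (hq : 1 ≤ q) (hmS : ∀ s, m s ≠ 0 → s ∈ S) (hsum : ∑ s ∈ S, m s = q)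
    (hA : ∑ s ∈ S, m s * s.1 = A₀) (hB : ∑ s ∈ S, m s * s.2 = A₀) (hn : n * ((q : ℝ) * a * b) = 2 * A₀)
    (hn2 : n ≤ 2) {z : ℕ × ℕ → ℝ} (hz0 : ∀ s ∈ S, 0 < z s)
    (hz : ∀ s ∈ S, z s ≤ (partitionFn β (spinSectorHamiltonian s.1 s.2 (hubbardOpenBoxTT' a b t t' U₀))).re)
    {Ls : ℕ → ℕ} (hLs : Tendsto Ls atTop atTop) {ε : ℝ} (hε : 0 < ε) :
    ∀ᶠ j in atTop, (((q : ℝ) * Real.log q - ∑ s ∈ S, (m s : ℝ) * Real.log (m s) +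
        ∑ s ∈ S, (m s : ℝ) * Real.log (z s)) / ((q : ℝ) * a * b) - ε) * (Ls j : ℝ) ^ 2 ≤
      Real.log (partitionFn β (sectorHamiltonianTT' t t' U n (Ls j))).re :=
  eventually_pressureFloor_of_le_U (density_nonneg_of_type ha hb hq hn) hn2 t t' hβ hU hLs
    (fun _ hδ => eventually_typeFreeEntropy_mul_sq_le_log_partitionFn_allTori t t' U₀ n hβ ha hb S m hq hmS hsum
      hA hB hn hn2 hz0 hz hLs hδ) hε

/-- **… and at every `U ≥ U₀` at the price of a certified thermal docc CEILING word `A` at `(β, U₀)`** (`β > 0`):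
the `hW` input `W − β(U − U₀)·A` at `U`, every `Ls → ∞`. [cite: Ruelle1969, §3.3] [cite: Lieb1973, §V (5.2)–(5.4)]
[cite: BratteliRobinsonI1987, Thm. 2.3.15 (weak-⋆ compactness of the state space) and §4.3.1] -/
theorem eventually_typeFreeEntropy_mul_sq_le_log_partitionFn_allTori_of_doccWord_left_U (t t' n : ℝ) {U₀ U : ℝ}
    (hU : U₀ ≤ U) {β : ℝ} (hβ : 0 < β) {a b : ℕ} (ha : 1 ≤ a) (hb : 1 ≤ b) (S : Finset (ℕ × ℕ))
    (m : ℕ × ℕ → ℕ) {q A₀ : ℕ} (hq : 1 ≤ q) (hmS : ∀ s, m s ≠ 0 → s ∈ S) (hsum : ∑ s ∈ S, m s = q)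
    (hA : ∑ s ∈ S, m s * s.1 = A₀) (hB : ∑ s ∈ S, m s * s.2 = A₀) (hn : n * ((q : ℝ) * a * b) = 2 * A₀)
    (hn2 : n ≤ 2) {z : ℕ × ℕ → ℝ} (hz0 : ∀ s ∈ S, 0 < z s)
    (hz : ∀ s ∈ S, z s ≤ (partitionFn β (spinSectorHamiltonian s.1 s.2 (hubbardOpenBoxTT' a b t t' U₀))).re)
    {A : ℝ}
    (hAw : ∀ (ω : InfVolFermionState 2) (Ls : ℕ → ℕ), Tendsto Ls atTop atTop →
      ω.IsTorusLimitOfMixture (sectorGibbsCount n) (fun L => sectorGibbsWeightTT' β t t' U₀ n L)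
        (fun L => sectorGibbsVectorTT' t t' U₀ n L) Ls →
      ω.meanEnergy (hubbardTTPrimeFermionInteraction 0 0 1) 1 ≤ A)
    {Ls : ℕ → ℕ} (hLs : Tendsto Ls atTop atTop) {ε : ℝ} (hε : 0 < ε) :
    ∀ᶠ j in atTop, (((q : ℝ) * Real.log q - ∑ s ∈ S, (m s : ℝ) * Real.log (m s) +
        ∑ s ∈ S, (m s : ℝ) * Real.log (z s)) / ((q : ℝ) * a * b) - β * (U - U₀) * A - ε) * (Ls j : ℝ) ^ 2 ≤
      Real.log (partitionFn β (sectorHamiltonianTT' t t' U n (Ls j))).re :=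
  eventually_pressureFloor_of_doccWord_left_U (density_nonneg_of_type ha hb hq hn) hn2 hβ le_rfl hU hAw hLs
    (fun _ hδ => eventually_typeFreeEntropy_mul_sq_le_log_partitionFn_allTori t t' U₀ n hβ.le ha hb S m hq hmS hsum
      hA hB hn hn2 hz0 hz hLs hδ) hε

/-- **CROSS-CORNER `U`-CELL edition of the upper temperature-axis edge, NO transport price.** Let `ω` be a torus
limit of the canonical sector Gibbs states of `H(t,t',U)` at `β` along `Ls → ∞` (`0 ≤ n ≤ 2`), `U ∈ [U₁, U₂]`,
`0 < β_h < β`. A pressure FLOOR at `β` certified at the RIGHT end (`∀ ε > 0, ∀ᶠ j, (W − ε)L² ≤ log Re Z_β(H(t,t',U₂)|_s)`)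
and a pressure CEILING at `β_h` certified at the LEFT end (`∀ ε > 0, ∀ᶠ j, log Re Z_{β_h}(H(t,t',U₁)|_s) ≤ (u + ε)L²`),
both along `Ls`, give `e_{Φ(t,t',U)}(ω) ≤ (u − W)/(β − β_h)` — the floor moves down and the ceiling up in `U` for
free, so ONE pair of corner inputs words the whole `U`-cell. [cite: Israel1979, Lemma II.3.1] [cite: Israel1979, Thm. I.3.4] -/
theorem IsTorusLimitOfMixture.meanEnergy_hubbardTTPrime_le_of_pressure_bounds_UCell (hn0 : 0 ≤ n) (hn2 : n ≤ 2)
    {U₁ U₂ : ℝ} (hU : U ∈ Set.Icc U₁ U₂)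
    (h : ω.IsTorusLimitOfMixture (sectorGibbsCount n) (fun L => sectorGibbsWeightTT' β t t' U n L)
      (fun L => sectorGibbsVectorTT' t t' U n L) Ls)
    (hLs : Tendsto Ls atTop atTop) {βh W u : ℝ} (hβh : 0 < βh) (hlt : βh < β)
    (hW : ∀ ε : ℝ, 0 < ε → ∀ᶠ j in atTop,
      (W - ε) * (Ls j : ℝ) ^ 2 ≤ Real.log (partitionFn β (sectorHamiltonianTT' t t' U₂ n (Ls j))).re)
    (hu : ∀ ε : ℝ, 0 < ε → ∀ᶠ j in atTop,
      Real.log (partitionFn βh (sectorHamiltonianTT' t t' U₁ n (Ls j))).re ≤ (u + ε) * (Ls j : ℝ) ^ 2) :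
    ω.meanEnergy (hubbardTTPrimeFermionInteraction t t' U) 1 ≤ (u - W) / (β - βh) :=
  h.meanEnergy_hubbardTTPrime_le_of_eventually_pressure_bounds hn0 hn2 hLs hβh hlt
    (fun ε hε => eventually_le_log_partitionFn_sectorHamiltonianTT'_of_le_U hn0 hn2 t t' (hβh.le.trans hlt.le)
      hU.2 hLs (hW ε hε))
    (fun ε hε => eventually_log_partitionFn_sectorHamiltonianTT'_le_fun_of_le_U hn0 hn2 t t' hβh.le hU.1 hLs
      (hu ε hε))

/-- **CROSS-CORNER `U`-CELL edition of the lower temperature-axis edge, NO transport price**: `0 < β < β_c`,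
`U ∈ [U₁, U₂]`; a pressure floor `W` at `β` certified at the RIGHT end `U₂` and a pressure ceiling `u` at `β_c`
certified at the LEFT end `U₁`, both along `Ls`, give `(W − u)/(β_c − β) ≤ e_{Φ(t,t',U)}(ω)` for every torus limit
`ω` at `(β, t, t', U, n)` along `Ls`. [cite: Israel1979, Lemma II.3.1] [cite: Israel1979, Thm. I.3.4] -/
theorem IsTorusLimitOfMixture.le_meanEnergy_hubbardTTPrime_of_pressure_bounds_UCell (hn0 : 0 ≤ n) (hn2 : n ≤ 2)
    {U₁ U₂ : ℝ} (hU : U ∈ Set.Icc U₁ U₂)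
    (h : ω.IsTorusLimitOfMixture (sectorGibbsCount n) (fun L => sectorGibbsWeightTT' β t t' U n L)
      (fun L => sectorGibbsVectorTT' t t' U n L) Ls)
    (hLs : Tendsto Ls atTop atTop) {βc W u : ℝ} (hβ : 0 < β) (hlt : β < βc)
    (hW : ∀ ε : ℝ, 0 < ε → ∀ᶠ j in atTop,
      (W - ε) * (Ls j : ℝ) ^ 2 ≤ Real.log (partitionFn β (sectorHamiltonianTT' t t' U₂ n (Ls j))).re)
    (hu : ∀ ε : ℝ, 0 < ε → ∀ᶠ j in atTop,
      Real.log (partitionFn βc (sectorHamiltonianTT' t t' U₁ n (Ls j))).re ≤ (u + ε) * (Ls j : ℝ) ^ 2) :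
    (W - u) / (βc - β) ≤ ω.meanEnergy (hubbardTTPrimeFermionInteraction t t' U) 1 :=
  h.le_meanEnergy_hubbardTTPrime_of_eventually_pressure_bounds hn0 hn2 hLs hβ hlt
    (fun ε hε => eventually_le_log_partitionFn_sectorHamiltonianTT'_of_le_U hn0 hn2 t t' hβ.le hU.2 hLs (hW ε hε))
    (fun ε hε => eventually_log_partitionFn_sectorHamiltonianTT'_le_fun_of_le_U hn0 hn2 t t' (hβ.le.trans hlt.le)
      hU.1 hLs (hu ε hε))

/-- **The upper edge at ANY `U` from both inputs at ONE anchor `U₀`, kinematic prices**: `e_{Φ(t,t',U)}(ω) ≤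
(u + β_h·max(U₀ − U, 0)·n/2 − (W − β·max(U − U₀, 0)·n/2))/(β − β_h)` (exactly one of the two `max` terms is
nonzero: below the anchor the hot ceiling pays, above it the cold floor pays). [cite: Israel1979, Lemma II.3.1]
[cite: Lieb1973, §V (5.2)–(5.4)] -/
theorem IsTorusLimitOfMixture.meanEnergy_hubbardTTPrime_le_of_pressure_bounds_anchorU_kinematic (hn0 : 0 ≤ n)
    (hn2 : n ≤ 2) (U₀ : ℝ)
    (h : ω.IsTorusLimitOfMixture (sectorGibbsCount n) (fun L => sectorGibbsWeightTT' β t t' U n L)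
      (fun L => sectorGibbsVectorTT' t t' U n L) Ls)
    (hLs : Tendsto Ls atTop atTop) {βh W u : ℝ} (hβh : 0 < βh) (hlt : βh < β)
    (hW : ∀ ε : ℝ, 0 < ε → ∀ᶠ j in atTop,
      (W - ε) * (Ls j : ℝ) ^ 2 ≤ Real.log (partitionFn β (sectorHamiltonianTT' t t' U₀ n (Ls j))).re)
    (hu : ∀ ε : ℝ, 0 < ε → ∀ᶠ j in atTop,
      Real.log (partitionFn βh (sectorHamiltonianTT' t t' U₀ n (Ls j))).re ≤ (u + ε) * (Ls j : ℝ) ^ 2) :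
    ω.meanEnergy (hubbardTTPrimeFermionInteraction t t' U) 1 ≤
      (u + βh * max (U₀ - U) 0 * (n / 2) - (W - β * max (U - U₀) 0 * (n / 2))) / (β - βh) :=
  h.meanEnergy_hubbardTTPrime_le_of_eventually_pressure_bounds hn0 hn2 hLs hβh hlt
    (fun _ hε => eventually_pressureFloor_of_anchorU_kinematic hn0 hn2 t t' (hβh.le.trans hlt.le) U₀ U hLs hW hε)
    (fun _ hε => eventually_pressureCeiling_of_anchorU_kinematic hn0 hn2 t t' hβh.le U₀ U hLs hu hε)

/-- **Upper edge of the thermal energy window on a whole `U`-CELL from a C2 certificate at the RIGHT end and a C1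
certificate at the LEFT end, every torus limit, no transport price** (square-lattice Hubbard model, `t' = 0`,
`U ∈ [U₁, U₂]`). C2 data at `(β, U₂)`: box `a × b`, sectors `S`, balanced base type `m` supported in `S`
(`Σ m_s = q ≥ 1`, `Σ m_s a_s = Σ m_s b_s = A₀`) of density `n = 2A₀/(q a b) ≤ 2`, floors
`0 < z_s ≤ Re Z_β(H^open_{a×b}(t,0,U₂); s)`. C1 data at `(β_h, μ, U₁)`, `0 < β_h < β` (`HubbardTorusMarkovRectWindow`):
rectangle `a' × b'` (`a', b' ≥ 2`) with annihilator, dual `L_B` and constant `c`. Then for every torus limit `ω` of the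
canonical sector Gibbs states of `H(t,0,U)` at `β` along any `Ls → ∞`:
`e_Φ(ω) ≤ ((c − β_h μ n) − W)/(β − β_h)`, `W = (q log q − Σ m_s log m_s + Σ m_s log z_s)/(q a b)`.
[cite: Israel1979, Lemma II.3.1] [cite: PoulinHastings2011, eqs. (3)–(8)] [cite: Ruelle1969, §3.3] -/
theorem IsTorusLimitOfMixture.meanEnergy_hubbardTTPrime_le_of_typeClass_right_of_rectMarkovCertificate_left_UCell_allTori
    (hn2 : n ≤ 2) {U₁ U₂ : ℝ} (hU : U ∈ Set.Icc U₁ U₂)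
    (h : ω.IsTorusLimitOfMixture (sectorGibbsCount n) (fun L => sectorGibbsWeightTT' β t 0 U n L)
      (fun L => sectorGibbsVectorTT' t 0 U n L) Ls)
    (hLs : Tendsto Ls atTop atTop) {βh : ℝ} (hβh : 0 < βh) (hlt : βh < β)
    -- C2 at `(β, U₂)`
    {a b : ℕ} (ha : 1 ≤ a) (hb : 1 ≤ b) (S : Finset (ℕ × ℕ)) (m : ℕ × ℕ → ℕ) {q A₀ : ℕ} (hq : 1 ≤ q)
    (hmS : ∀ s, m s ≠ 0 → s ∈ S) (hsum : ∑ s ∈ S, m s = q) (hA : ∑ s ∈ S, m s * s.1 = A₀)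
    (hB : ∑ s ∈ S, m s * s.2 = A₀) (hn : n * ((q : ℝ) * a * b) = 2 * A₀) {z : ℕ × ℕ → ℝ}
    (hz0 : ∀ s ∈ S, 0 < z s)
    (hz : ∀ s ∈ S, z s ≤ (partitionFn β (spinSectorHamiltonian s.1 s.2 (hubbardOpenBoxTT' a b t 0 U₂))).re)
    -- C1 at `(βh, U₁)`
    (μ : ℝ) {a' b' : ℕ} (ha' : 2 ≤ a') (hb' : 2 ≤ b')
    {ι : Type*} (sι : Finset ι) (Sw : ι → Finset (Site 2)) (hS : ∀ i, Sw i ⊆ rectWindow a' b') (zw : ι → Site 2)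
    (hzw : ∀ i, shiftSet (zw i) (Sw i) ⊆ rectWindow a' b') {O : ∀ i, FermionOp (Sw i)}
    (hO : ∀ i ∈ sι, (O i).IsHermitian) (g : ι → ℝ)
    {LB : FermionOp ((rectWindow a' b').erase (mkSite2 (a' - 1) (b' - 1)))} (hLB : LB.IsHermitian) {c : ℝ}
    (hcert : ((Real.exp c : ℂ) • cfc Real.exp LB -
      fermionPartialTrace (PolySite.incl (Finset.erase_subset (mkSite2 (a' - 1) (b' - 1)) (rectWindow a' b')))
        (cfc Real.exp (-((βh : ℂ) • (cornerEnergyRep (rectWindow a' b') (mkSite2 (a' - 1) (b' - 1)) t U₁ μ +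
            windowAnnihilator sι (rectWindow a' b') Sw hS zw hzw O g)) +
          fermionEmbed (PolySite.incl (Finset.erase_subset (mkSite2 (a' - 1) (b' - 1)) (rectWindow a' b'))) LB))).PosSemidef) :
    ω.meanEnergy (hubbardTTPrimeFermionInteraction t 0 U) 1 ≤
      ((c - βh * μ * n) - ((q : ℝ) * Real.log q - ∑ s ∈ S, (m s : ℝ) * Real.log (m s) +
        ∑ s ∈ S, (m s : ℝ) * Real.log (z s)) / ((q : ℝ) * a * b)) / (β - βh) := by
  have hβ : 0 ≤ β := (hβh.trans hlt).le
  have hn0 : 0 ≤ n := density_nonneg_of_type ha hb hq hn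
  refine h.meanEnergy_hubbardTTPrime_le_of_pressure_bounds_UCell hn0 hn2 hU hLs hβh hlt
    (fun ε hε => eventually_typeFreeEntropy_mul_sq_le_log_partitionFn_allTori t 0 U₂ n hβ ha hb S m hq hmS hsum
      hA hB hn hn2 hz0 hz hLs hε)
    (fun ε hε => ?_)
  have hKTI : ∀ (L : ℕ) [NeZero L], ∀ w : TorusSite 2 L,
      relabel (Orb.translate w) (hubbardTorusTT' L t 0 U₁ - (μ : ℂ) • totalNumber) =
        hubbardTorusTT' L t 0 U₁ - (μ : ℂ) • totalNumber := fun L _ w => by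
    rw [hubbardTorusTT'_zero_sub_mu, relabel_translate_hubbardTorusWith]
  exact eventually_log_partitionFn_sectorHamiltonianTT'_le_of_clusterCertificate t U₁ μ βh hn0 hn2 hLs
    (rectCorner_mem_rectWindow (by omega) (by omega)) toLex_le_toLex_rectCorner
    (rectWindow_subset_halfOpenBox_max a' b')
    (fun i => bondWeightSum_cornerBondWeight (rectCorner_mem_rectWindow (by omega) (by omega))
      (rectCorner_sub_unitVec_mem_rectWindow ha' hb' i))
    (siteWeightSum_cornerSiteWeight (rectCorner_mem_rectWindow (by omega) (by omega)))
    (siteWeightSum_mul_cornerSiteWeight (rectCorner_mem_rectWindow (by omega) (by omega)) (-μ))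
    (isHermitian_windowAnnihilator sι _ Sw hS zw hzw hO g)
    (fun L _ hL3 hℓL => trace_window_mul_windowAnnihilator (relabel_translate_gibbsDensity L (hKTI L) βh)
      _ sι Sw hS zw hzw O g) hLB hcert hε

/-- **Lower edge of the thermal energy window on a whole `U`-CELL from a C2 certificate at the RIGHT end (`β`) and a
C1 certificate at the LEFT end at a colder `β_c > β`, every torus limit, no transport price** (same data, the C1
certificate at `(β_c, μ, U₁)`): `(W − (c − β_c μ n))/(β_c − β) ≤ e_Φ(ω)` for every torus limit at `(β, t, 0, U, n)`,
`U ∈ [U₁, U₂]`. [cite: Israel1979, Lemma II.3.1] [cite: PoulinHastings2011, eqs. (3)–(8)] [cite: Ruelle1969, §3.3] -/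
theorem IsTorusLimitOfMixture.le_meanEnergy_hubbardTTPrime_of_typeClass_right_of_rectMarkovCertificate_left_UCell_allTori
    (hn2 : n ≤ 2) {U₁ U₂ : ℝ} (hU : U ∈ Set.Icc U₁ U₂)
    (h : ω.IsTorusLimitOfMixture (sectorGibbsCount n) (fun L => sectorGibbsWeightTT' β t 0 U n L)
      (fun L => sectorGibbsVectorTT' t 0 U n L) Ls)
    (hLs : Tendsto Ls atTop atTop) (hβ : 0 < β) {βc : ℝ} (hlt : β < βc)
    -- C2 at `(β, U₂)`
    {a b : ℕ} (ha : 1 ≤ a) (hb : 1 ≤ b) (S : Finset (ℕ × ℕ)) (m : ℕ × ℕ → ℕ) {q A₀ : ℕ} (hq : 1 ≤ q)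
    (hmS : ∀ s, m s ≠ 0 → s ∈ S) (hsum : ∑ s ∈ S, m s = q) (hA : ∑ s ∈ S, m s * s.1 = A₀)
    (hB : ∑ s ∈ S, m s * s.2 = A₀) (hn : n * ((q : ℝ) * a * b) = 2 * A₀) {z : ℕ × ℕ → ℝ}
    (hz0 : ∀ s ∈ S, 0 < z s)
    (hz : ∀ s ∈ S, z s ≤ (partitionFn β (spinSectorHamiltonian s.1 s.2 (hubbardOpenBoxTT' a b t 0 U₂))).re)
    -- C1 at `(βc, U₁)`
    (μ : ℝ) {a' b' : ℕ} (ha' : 2 ≤ a') (hb' : 2 ≤ b')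
    {ι : Type*} (sι : Finset ι) (Sw : ι → Finset (Site 2)) (hS : ∀ i, Sw i ⊆ rectWindow a' b') (zw : ι → Site 2)
    (hzw : ∀ i, shiftSet (zw i) (Sw i) ⊆ rectWindow a' b') {O : ∀ i, FermionOp (Sw i)}
    (hO : ∀ i ∈ sι, (O i).IsHermitian) (g : ι → ℝ)
    {LB : FermionOp ((rectWindow a' b').erase (mkSite2 (a' - 1) (b' - 1)))} (hLB : LB.IsHermitian) {c : ℝ}
    (hcert : ((Real.exp c : ℂ) • cfc Real.exp LB -
      fermionPartialTrace (PolySite.incl (Finset.erase_subset (mkSite2 (a' - 1) (b' - 1)) (rectWindow a' b')))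
        (cfc Real.exp (-((βc : ℂ) • (cornerEnergyRep (rectWindow a' b') (mkSite2 (a' - 1) (b' - 1)) t U₁ μ +
            windowAnnihilator sι (rectWindow a' b') Sw hS zw hzw O g)) +
          fermionEmbed (PolySite.incl (Finset.erase_subset (mkSite2 (a' - 1) (b' - 1)) (rectWindow a' b'))) LB))).PosSemidef) :
    (((q : ℝ) * Real.log q - ∑ s ∈ S, (m s : ℝ) * Real.log (m s) + ∑ s ∈ S, (m s : ℝ) * Real.log (z s)) /
        ((q : ℝ) * a * b) - (c - βc * μ * n)) / (βc - β) ≤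
      ω.meanEnergy (hubbardTTPrimeFermionInteraction t 0 U) 1 := by
  have hn0 : 0 ≤ n := density_nonneg_of_type ha hb hq hn
  refine h.le_meanEnergy_hubbardTTPrime_of_pressure_bounds_UCell hn0 hn2 hU hLs hβ hlt
    (fun ε hε => eventually_typeFreeEntropy_mul_sq_le_log_partitionFn_allTori t 0 U₂ n hβ.le ha hb S m hq hmS
      hsum hA hB hn hn2 hz0 hz hLs hε)
    (fun ε hε => ?_)
  have hKTI : ∀ (L : ℕ) [NeZero L], ∀ w : TorusSite 2 L,
      relabel (Orb.translate w) (hubbardTorusTT' L t 0 U₁ - (μ : ℂ) • totalNumber) =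
        hubbardTorusTT' L t 0 U₁ - (μ : ℂ) • totalNumber := fun L _ w => by
    rw [hubbardTorusTT'_zero_sub_mu, relabel_translate_hubbardTorusWith]
  exact eventually_log_partitionFn_sectorHamiltonianTT'_le_of_clusterCertificate t U₁ μ βc hn0 hn2 hLs
    (rectCorner_mem_rectWindow (by omega) (by omega)) toLex_le_toLex_rectCorner
    (rectWindow_subset_halfOpenBox_max a' b')
    (fun i => bondWeightSum_cornerBondWeight (rectCorner_mem_rectWindow (by omega) (by omega))
      (rectCorner_sub_unitVec_mem_rectWindow ha' hb' i))
    (siteWeightSum_cornerSiteWeight (rectCorner_mem_rectWindow (by omega) (by omega)))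
    (siteWeightSum_mul_cornerSiteWeight (rectCorner_mem_rectWindow (by omega) (by omega)) (-μ))
    (isHermitian_windowAnnihilator sι _ Sw hS zw hzw hO g)
    (fun L _ hL3 hℓL => trace_window_mul_windowAnnihilator (relabel_translate_gibbsDensity L (hKTI L) βc)
      _ sι Sw hS zw hzw O g) hLB hcert hε

end Compositions

end InfVolFermionState

end Literature.MathematicalPhysics.QuantumLattice

end

/-! ### §7 (appended) Thermal docc WORDS from two pressure inputs: the `U`-chord (Legendre) readout

The Peierls–Bogoliubov bracket `β(U₂−U₁)⟨D⟩_{L,U₂} ≤ log Z_L(U₁) − log Z_L(U₂) ≤ β(U₂−U₁)⟨D⟩_{L,U₁}` read as a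
PRODUCER of the docc-word currency: a pressure CEILING at `U₁` and a pressure FLOOR at `U₂ > U₁` (same `β`, along the
tori of the limit) bound the thermal docc of every torus limit at `U₂` from ABOVE; a floor at `U₁` and a ceiling at
`U₂` bound the thermal docc at `U₁` from BELOW — the `T > 0` twin of the cap/cut chords of `HubbardTTPrimeCapCutDualRows`
§8 and the `U`-twin of the temperature chords `IsTorusLimitOfMixture.meanEnergy_hubbardTTPrime_le_chord_of_sectorGibbs`
(energies from pressures at two `β`). With inputs valid along EVERY `Ls → ∞` (the all-tori producers) the bounds are
docc WORDS on the whole half-lines `U ≥ U₂` / `U ≤ U₁` (`HubbardTTPrimeDoccTransportThermal` §3) — the currency of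
§4–§5 above, of `HubbardTTPrimeHotFreeEnergyBoundUTransport` §4 and of the docc-priced thermal cap transport. -/

noncomputable section

namespace Literature.MathematicalPhysics.QuantumLattice

open Matrix Finset HubbardWave0 ThermodynamicLimit LiebThm1 Literature.Probability.LatticeModels
open _root_.Filter
open scoped _root_.Topology ComplexOrder BigOperators

namespace InfVolFermionState

section DoccFromPressures

variable {t s n β : ℝ} {ω : InfVolFermionState 2} {Ls : ℕ → ℕ}

/-- **Thermal docc CEILING from a pressure ceiling at `U₁` and a pressure floor at `U₂ > U₁`** (`β > 0`,
`0 ≤ n ≤ 2`): for a torus limit `ω` of the canonical sector Gibbs states of `H(t,s,U₂)` at `β` along `Ls → ∞`, if along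
`Ls` `∀ ε > 0, ∀ᶠ j, log Re Z_β(H(t,s,U₁)|_s) ≤ (u + ε)L²` and `∀ ε > 0, ∀ᶠ j, (W − ε)L² ≤ log Re Z_β(H(t,s,U₂)|_s)`, then
`D(ω) ≤ (u − W)/(β(U₂ − U₁))` (lower Peierls–Bogoliubov side at `U₂`, passed to the limit along `Ls`).
[cite: Lieb1973, §V (5.2)–(5.4)] [cite: Israel1979, Lemma II.3.1] -/
theorem IsTorusLimitOfMixture.meanEnergy_onSite_le_of_pressure_bounds_U (hn0 : 0 ≤ n) (hn2 : n ≤ 2) (hβ : 0 < β)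
    {U₁ U₂ : ℝ} (hU : U₁ < U₂)
    (h : ω.IsTorusLimitOfMixture (sectorGibbsCount n) (fun L => sectorGibbsWeightTT' β t s U₂ n L)
      (fun L => sectorGibbsVectorTT' t s U₂ n L) Ls)
    (hLs : Tendsto Ls atTop atTop) {u W : ℝ}
    (hu : ∀ ε : ℝ, 0 < ε → ∀ᶠ j in atTop,
      Real.log (partitionFn β (sectorHamiltonianTT' t s U₁ n (Ls j))).re ≤ (u + ε) * (Ls j : ℝ) ^ 2)
    (hW : ∀ ε : ℝ, 0 < ε → ∀ᶠ j in atTop,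
      (W - ε) * (Ls j : ℝ) ^ 2 ≤ Real.log (partitionFn β (sectorHamiltonianTT' t s U₂ n (Ls j))).re) :
    ω.meanEnergy (hubbardTTPrimeFermionInteraction 0 0 1) 1 ≤ (u - W) / (β * (U₂ - U₁)) := by
  have hd : 0 < β * (U₂ - U₁) := mul_pos hβ (sub_pos.2 hU)
  have hlim := h.tendsto_meanEnergy_hubbardTTPrime 0 0 1 hLs
  refine le_of_forall_pos_le_add fun δ hδ => ?_
  set ε : ℝ := δ * (β * (U₂ - U₁)) / 2 with hε
  have hεpos : 0 < ε := by positivity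
  refine le_of_tendsto hlim ?_
  filter_upwards [hu ε hεpos, hW ε hεpos, hLs.eventually_ge_atTop 1] with j huj hWj hj1
  haveI : NeZero (Ls j) := ⟨by omega⟩
  have hL1 : (1 : ℝ) ≤ (Ls j : ℝ) := by exact_mod_cast hj1
  have hL2 : (0 : ℝ) < (Ls j : ℝ) ^ 2 := by positivity
  have hb := (log_partitionFn_sector_sub_mem_Icc_U hn0 hn2 (Ls j) t s β U₁ U₂).1
  have hsum : (∑ i, sectorGibbsWeightTT' β t s U₂ n (Ls j) i *
      ((QuantumLattice.expect (hubbardTorusTT' (Ls j) 0 0 1) (sectorGibbsVectorTT' t s U₂ n (Ls j) i)).re /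
        (Ls j : ℝ) ^ 2)) =
      (∑ i, sectorGibbsWeightTT' β t s U₂ n (Ls j) i *
        (QuantumLattice.expect (hubbardTorusTT' (Ls j) 0 0 1) (sectorGibbsVectorTT' t s U₂ n (Ls j) i)).re) /
        (Ls j : ℝ) ^ 2 := by
    rw [Finset.sum_div]
    exact Finset.sum_congr rfl fun i _ => by ring
  show (∑ i, sectorGibbsWeightTT' β t s U₂ n (Ls j) i *
      ((QuantumLattice.expect (hubbardTorusTT' (Ls j) 0 0 1) (sectorGibbsVectorTT' t s U₂ n (Ls j) i)).re /
        (Ls j : ℝ) ^ 2)) ≤ (u - W) / (β * (U₂ - U₁)) + δ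
  rw [hsum, div_le_iff₀ hL2]
  have hm : β * (U₂ - U₁) * (∑ i, sectorGibbsWeightTT' β t s U₂ n (Ls j) i *
        (QuantumLattice.expect (hubbardTorusTT' (Ls j) 0 0 1) (sectorGibbsVectorTT' t s U₂ n (Ls j) i)).re) ≤
      (u - W + 2 * ε) * (Ls j : ℝ) ^ 2 := by nlinarith [hb, huj, hWj]
  have hΔ : U₂ - U₁ ≠ 0 := (sub_pos.2 hU).ne'
  have hβ0 : β ≠ 0 := hβ.ne'
  have heq : (u - W) / (β * (U₂ - U₁)) + δ = (u - W + 2 * ε) / (β * (U₂ - U₁)) := by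
    rw [hε]
    field_simp
  rw [heq, div_mul_eq_mul_div, le_div_iff₀ hd]
  nlinarith [hm]

/-- **Thermal docc FLOOR from a pressure floor at `U₁` and a pressure ceiling at `U₂ > U₁`** (`β > 0`,
`0 ≤ n ≤ 2`): for a torus limit `ω` of the canonical sector Gibbs states of `H(t,s,U₁)` at `β` along `Ls → ∞`, if along
`Ls` `∀ ε > 0, ∀ᶠ j, (W − ε)L² ≤ log Re Z_β(H(t,s,U₁)|_s)` and `∀ ε > 0, ∀ᶠ j, log Re Z_β(H(t,s,U₂)|_s) ≤ (u + ε)L²`, then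
`(W − u)/(β(U₂ − U₁)) ≤ D(ω)` (upper Peierls–Bogoliubov side at `U₁`). [cite: Lieb1973, §V (5.2)–(5.4)]
[cite: Israel1979, Lemma II.3.1] -/
theorem IsTorusLimitOfMixture.le_meanEnergy_onSite_of_pressure_bounds_U (hn0 : 0 ≤ n) (hn2 : n ≤ 2) (hβ : 0 < β)
    {U₁ U₂ : ℝ} (hU : U₁ < U₂)
    (h : ω.IsTorusLimitOfMixture (sectorGibbsCount n) (fun L => sectorGibbsWeightTT' β t s U₁ n L)
      (fun L => sectorGibbsVectorTT' t s U₁ n L) Ls)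
    (hLs : Tendsto Ls atTop atTop) {W u : ℝ}
    (hW : ∀ ε : ℝ, 0 < ε → ∀ᶠ j in atTop,
      (W - ε) * (Ls j : ℝ) ^ 2 ≤ Real.log (partitionFn β (sectorHamiltonianTT' t s U₁ n (Ls j))).re)
    (hu : ∀ ε : ℝ, 0 < ε → ∀ᶠ j in atTop,
      Real.log (partitionFn β (sectorHamiltonianTT' t s U₂ n (Ls j))).re ≤ (u + ε) * (Ls j : ℝ) ^ 2) :
    (W - u) / (β * (U₂ - U₁)) ≤ ω.meanEnergy (hubbardTTPrimeFermionInteraction 0 0 1) 1 := by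
  have hd : 0 < β * (U₂ - U₁) := mul_pos hβ (sub_pos.2 hU)
  have hlim := h.tendsto_meanEnergy_hubbardTTPrime 0 0 1 hLs
  -- `a - δ ≤ D` for every `δ > 0`
  have key : ∀ δ : ℝ, 0 < δ → (W - u) / (β * (U₂ - U₁)) - δ ≤ ω.meanEnergy (hubbardTTPrimeFermionInteraction 0 0 1) 1 := by
    intro δ hδ
    set ε : ℝ := δ * (β * (U₂ - U₁)) / 2 with hε
    have hεpos : 0 < ε := by positivity
    refine ge_of_tendsto hlim ?_
    filter_upwards [hW ε hεpos, hu ε hεpos, hLs.eventually_ge_atTop 1] with j hWj huj hj1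
    haveI : NeZero (Ls j) := ⟨by omega⟩
    have hL1 : (1 : ℝ) ≤ (Ls j : ℝ) := by exact_mod_cast hj1
    have hL2 : (0 : ℝ) < (Ls j : ℝ) ^ 2 := by positivity
    have hb := (log_partitionFn_sector_sub_mem_Icc_U hn0 hn2 (Ls j) t s β U₁ U₂).2
    have hsum : (∑ i, sectorGibbsWeightTT' β t s U₁ n (Ls j) i *
        ((QuantumLattice.expect (hubbardTorusTT' (Ls j) 0 0 1) (sectorGibbsVectorTT' t s U₁ n (Ls j) i)).re /
          (Ls j : ℝ) ^ 2)) =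
        (∑ i, sectorGibbsWeightTT' β t s U₁ n (Ls j) i *
          (QuantumLattice.expect (hubbardTorusTT' (Ls j) 0 0 1) (sectorGibbsVectorTT' t s U₁ n (Ls j) i)).re) /
          (Ls j : ℝ) ^ 2 := by
      rw [Finset.sum_div]
      exact Finset.sum_congr rfl fun i _ => by ring
    show (W - u) / (β * (U₂ - U₁)) - δ ≤ ∑ i, sectorGibbsWeightTT' β t s U₁ n (Ls j) i *
        ((QuantumLattice.expect (hubbardTorusTT' (Ls j) 0 0 1) (sectorGibbsVectorTT' t s U₁ n (Ls j) i)).re /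
          (Ls j : ℝ) ^ 2)
    rw [hsum, le_div_iff₀ hL2]
    have hm : (W - u - 2 * ε) * (Ls j : ℝ) ^ 2 ≤ β * (U₂ - U₁) *
        (∑ i, sectorGibbsWeightTT' β t s U₁ n (Ls j) i *
          (QuantumLattice.expect (hubbardTorusTT' (Ls j) 0 0 1) (sectorGibbsVectorTT' t s U₁ n (Ls j) i)).re) := by
      nlinarith [hb, huj, hWj]
    have hΔ : U₂ - U₁ ≠ 0 := (sub_pos.2 hU).ne'
    have hβ0 : β ≠ 0 := hβ.ne'
    have heq : (W - u) / (β * (U₂ - U₁)) - δ = (W - u - 2 * ε) / (β * (U₂ - U₁)) := by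
      rw [hε]
      field_simp
    rw [heq, div_mul_eq_mul_div, div_le_iff₀ hd]
    nlinarith [hm]
  refine le_of_forall_pos_le_add fun δ hδ => ?_
  linarith [key δ hδ]

/-- **Docc CEILING WORD on the half-line `U ≥ U₂` from all-tori pressure inputs**: if the pressure ceiling `u` at
`(β, U₁)` and the pressure floor `W` at `(β, U₂)`, `U₁ < U₂`, hold along EVERY `Ls → ∞` (the all-tori producers), then
`D(ω) ≤ (u − W)/(β(U₂ − U₁))` for every torus limit `ω` of the canonical sector Gibbs states at `(β, t, s, U, n)`,
every `U ≥ U₂`, along any tori (the docc mean is antitone in `U`). [cite: Lieb1973, §V (5.2)–(5.4)]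
[cite: KomaTasaki1994, §1] -/
theorem IsTorusLimitOfMixture.meanEnergy_onSite_le_of_pressure_bounds_U_allTori (hn0 : 0 ≤ n) (hn2 : n ≤ 2)
    (hβ : 0 < β) {U₁ U₂ U : ℝ} (hU : U₁ < U₂) (hUU : U₂ ≤ U) {u W : ℝ}
    (hu : ∀ (Ls' : ℕ → ℕ), Tendsto Ls' atTop atTop → ∀ ε : ℝ, 0 < ε → ∀ᶠ j in atTop,
      Real.log (partitionFn β (sectorHamiltonianTT' t s U₁ n (Ls' j))).re ≤ (u + ε) * (Ls' j : ℝ) ^ 2)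
    (hW : ∀ (Ls' : ℕ → ℕ), Tendsto Ls' atTop atTop → ∀ ε : ℝ, 0 < ε → ∀ᶠ j in atTop,
      (W - ε) * (Ls' j : ℝ) ^ 2 ≤ Real.log (partitionFn β (sectorHamiltonianTT' t s U₂ n (Ls' j))).re)
    (h : ω.IsTorusLimitOfMixture (sectorGibbsCount n) (fun L => sectorGibbsWeightTT' β t s U n L)
      (fun L => sectorGibbsVectorTT' t s U n L) Ls)
    (hLs : Tendsto Ls atTop atTop) :
    ω.meanEnergy (hubbardTTPrimeFermionInteraction 0 0 1) 1 ≤ (u - W) / (β * (U₂ - U₁)) :=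
  h.meanEnergy_onSite_le_of_forall_left_U_of_sectorGibbs hn0 hn2 hβ hUU
    (fun _ Ls₂ hLs₂ h₂ => h₂.meanEnergy_onSite_le_of_pressure_bounds_U hn0 hn2 hβ hU hLs₂ (hu Ls₂ hLs₂)
      (hW Ls₂ hLs₂)) hLs

/-- **Docc FLOOR WORD on the half-line `U ≤ U₁` from all-tori pressure inputs**: a pressure floor `W` at `(β, U₁)`
and a pressure ceiling `u` at `(β, U₂)`, `U₁ < U₂`, along every `Ls → ∞`, give `(W − u)/(β(U₂ − U₁)) ≤ D(ω)` for
every torus limit at `(β, t, s, U, n)`, every `U ≤ U₁`. [cite: Lieb1973, §V (5.2)–(5.4)] [cite: KomaTasaki1994, §1] -/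
theorem IsTorusLimitOfMixture.le_meanEnergy_onSite_of_pressure_bounds_U_allTori (hn0 : 0 ≤ n) (hn2 : n ≤ 2)
    (hβ : 0 < β) {U U₁ U₂ : ℝ} (hUU : U ≤ U₁) (hU : U₁ < U₂) {W u : ℝ}
    (hW : ∀ (Ls' : ℕ → ℕ), Tendsto Ls' atTop atTop → ∀ ε : ℝ, 0 < ε → ∀ᶠ j in atTop,
      (W - ε) * (Ls' j : ℝ) ^ 2 ≤ Real.log (partitionFn β (sectorHamiltonianTT' t s U₁ n (Ls' j))).re)
    (hu : ∀ (Ls' : ℕ → ℕ), Tendsto Ls' atTop atTop → ∀ ε : ℝ, 0 < ε → ∀ᶠ j in atTop,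
      Real.log (partitionFn β (sectorHamiltonianTT' t s U₂ n (Ls' j))).re ≤ (u + ε) * (Ls' j : ℝ) ^ 2)
    (h : ω.IsTorusLimitOfMixture (sectorGibbsCount n) (fun L => sectorGibbsWeightTT' β t s U n L)
      (fun L => sectorGibbsVectorTT' t s U n L) Ls)
    (hLs : Tendsto Ls atTop atTop) :
    (W - u) / (β * (U₂ - U₁)) ≤ ω.meanEnergy (hubbardTTPrimeFermionInteraction 0 0 1) 1 :=
  h.le_meanEnergy_onSite_of_forall_right_U_of_sectorGibbs hn0 hn2 hβ hUU
    (fun _ Ls₁ hLs₁ h₁ => h₁.le_meanEnergy_onSite_of_pressure_bounds_U hn0 hn2 hβ hU hLs₁ (hW Ls₁ hLs₁)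
      (hu Ls₁ hLs₁)) hLs

/-- **Docc CEILING WORD from a C2 type-class floor at the RIGHT node and a pressure ceiling at the LEFT node**
(all tori; `β > 0`; C2 data at `(t, t', U₂)` with `W = (q log q − Σ m_s log m_s + Σ m_s log z_s)/(q a b)`; any all-tori
pressure ceiling `u` at `(β, U₁)`, `U₁ < U₂`): `D(ω) ≤ (u − W)/(β(U₂ − U₁))` for every torus limit of the canonical
sector Gibbs states at `(β, t, t', U, n)`, every `U ≥ U₂` — a certified thermal docc row produced by the free-energy
route's own certificates. [cite: Ruelle1969, §3.3] [cite: Lieb1973, §V (5.2)–(5.4)] [cite: KomaTasaki1994, §1] -/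
theorem IsTorusLimitOfMixture.meanEnergy_onSite_le_of_typeClass_right_of_pressureCeiling_left_U_allTori
    {t t' n U₁ U₂ U : ℝ} (hU : U₁ < U₂) (hUU : U₂ ≤ U) {β : ℝ} (hβ : 0 < β)
    {a b : ℕ} (ha : 1 ≤ a) (hb : 1 ≤ b) (S : Finset (ℕ × ℕ)) (m : ℕ × ℕ → ℕ) {q A₀ : ℕ} (hq : 1 ≤ q)
    (hmS : ∀ s, m s ≠ 0 → s ∈ S) (hsum : ∑ s ∈ S, m s = q) (hA : ∑ s ∈ S, m s * s.1 = A₀)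
    (hB : ∑ s ∈ S, m s * s.2 = A₀) (hn : n * ((q : ℝ) * a * b) = 2 * A₀) (hn2 : n ≤ 2)
    {z : ℕ × ℕ → ℝ} (hz0 : ∀ s ∈ S, 0 < z s)
    (hz : ∀ s ∈ S, z s ≤ (partitionFn β (spinSectorHamiltonian s.1 s.2 (hubbardOpenBoxTT' a b t t' U₂))).re)
    {u : ℝ}
    (hu : ∀ (Ls' : ℕ → ℕ), Tendsto Ls' atTop atTop → ∀ ε : ℝ, 0 < ε → ∀ᶠ j in atTop,
      Real.log (partitionFn β (sectorHamiltonianTT' t t' U₁ n (Ls' j))).re ≤ (u + ε) * (Ls' j : ℝ) ^ 2)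
    {ω : InfVolFermionState 2} {Ls : ℕ → ℕ}
    (h : ω.IsTorusLimitOfMixture (sectorGibbsCount n) (fun L => sectorGibbsWeightTT' β t t' U n L)
      (fun L => sectorGibbsVectorTT' t t' U n L) Ls)
    (hLs : Tendsto Ls atTop atTop) :
    ω.meanEnergy (hubbardTTPrimeFermionInteraction 0 0 1) 1 ≤
      (u - ((q : ℝ) * Real.log q - ∑ s ∈ S, (m s : ℝ) * Real.log (m s) + ∑ s ∈ S, (m s : ℝ) * Real.log (z s)) /
        ((q : ℝ) * a * b)) / (β * (U₂ - U₁)) :=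
  h.meanEnergy_onSite_le_of_pressure_bounds_U_allTori (density_nonneg_of_type ha hb hq hn) hn2 hβ hU hUU hu
    (fun _ hLs' _ hε => eventually_typeFreeEntropy_mul_sq_le_log_partitionFn_allTori t t' U₂ n hβ.le ha hb S m hq
      hmS hsum hA hB hn hn2 hz0 hz hLs' hε) hLs

/-- **Docc FLOOR WORD from a C2 type-class floor at the LEFT node and a pressure ceiling at the RIGHT node** (all
tori; C2 data at `(t, t', U₁)`, any all-tori pressure ceiling `u` at `(β, U₂)`, `U₁ < U₂`):
`(W − u)/(β(U₂ − U₁)) ≤ D(ω)` for every torus limit at `(β, t, t', U, n)`, every `U ≤ U₁`.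
[cite: Ruelle1969, §3.3] [cite: Lieb1973, §V (5.2)–(5.4)] [cite: KomaTasaki1994, §1] -/
theorem IsTorusLimitOfMixture.le_meanEnergy_onSite_of_typeClass_left_of_pressureCeiling_right_U_allTori
    {t t' n U U₁ U₂ : ℝ} (hUU : U ≤ U₁) (hU : U₁ < U₂) {β : ℝ} (hβ : 0 < β)
    {a b : ℕ} (ha : 1 ≤ a) (hb : 1 ≤ b) (S : Finset (ℕ × ℕ)) (m : ℕ × ℕ → ℕ) {q A₀ : ℕ} (hq : 1 ≤ q)
    (hmS : ∀ s, m s ≠ 0 → s ∈ S) (hsum : ∑ s ∈ S, m s = q) (hA : ∑ s ∈ S, m s * s.1 = A₀)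
    (hB : ∑ s ∈ S, m s * s.2 = A₀) (hn : n * ((q : ℝ) * a * b) = 2 * A₀) (hn2 : n ≤ 2)
    {z : ℕ × ℕ → ℝ} (hz0 : ∀ s ∈ S, 0 < z s)
    (hz : ∀ s ∈ S, z s ≤ (partitionFn β (spinSectorHamiltonian s.1 s.2 (hubbardOpenBoxTT' a b t t' U₁))).re)
    {u : ℝ}
    (hu : ∀ (Ls' : ℕ → ℕ), Tendsto Ls' atTop atTop → ∀ ε : ℝ, 0 < ε → ∀ᶠ j in atTop,
      Real.log (partitionFn β (sectorHamiltonianTT' t t' U₂ n (Ls' j))).re ≤ (u + ε) * (Ls' j : ℝ) ^ 2)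
    {ω : InfVolFermionState 2} {Ls : ℕ → ℕ}
    (h : ω.IsTorusLimitOfMixture (sectorGibbsCount n) (fun L => sectorGibbsWeightTT' β t t' U n L)
      (fun L => sectorGibbsVectorTT' t t' U n L) Ls)
    (hLs : Tendsto Ls atTop atTop) :
    (((q : ℝ) * Real.log q - ∑ s ∈ S, (m s : ℝ) * Real.log (m s) + ∑ s ∈ S, (m s : ℝ) * Real.log (z s)) /
        ((q : ℝ) * a * b) - u) / (β * (U₂ - U₁)) ≤
      ω.meanEnergy (hubbardTTPrimeFermionInteraction 0 0 1) 1 :=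
  h.le_meanEnergy_onSite_of_pressure_bounds_U_allTori (density_nonneg_of_type ha hb hq hn) hn2 hβ hUU hU
    (fun _ hLs' _ hε => eventually_typeFreeEntropy_mul_sq_le_log_partitionFn_allTori t t' U₁ n hβ.le ha hb S m hq
      hmS hsum hA hB hn hn2 hz0 hz hLs' hε) hu hLs

end DoccFromPressures

end InfVolFermionState

end Literature.MathematicalPhysics.QuantumLattice

end

/-! ### §8 (appended) The cross-corner `U`-cell windows at `t' ≠ 0`: C2 at the right end, the `t–t'` rectangle
Markov (C1) certificate at the left end

The cuprate boxes of the material oracle sit at `t' ≠ 0`. `HubbardThermalAxisWindowAllToriTTPrime` words ONE point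
`(t, t', U)` from a C2 sidecar and a `t–t'` rectangle Markov certificate (`cornerEnergyRepTT'`,
`eventually_log_partitionFn_sectorHamiltonianTT'_le_of_clusterCertificateTT'`) at that point; here the same two
certificates, placed at the two ends of a `U`-cell, word the whole cell (§6 `…_of_pressure_bounds_UCell`). -/

noncomputable section

namespace Literature.MathematicalPhysics.QuantumLattice

open Matrix Finset HubbardWave0 ThermodynamicLimit LiebThm1 AndersonCluster Literature.Probability.LatticeModels
open _root_.Filter
open scoped _root_.Topology ComplexOrder BigOperators

namespace InfVolFermionState

section CellTTPrime

variable {t t' U n β : ℝ} {ω : InfVolFermionState 2} {Ls : ℕ → ℕ}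

/-- **Upper edge on a whole `U`-CELL at `t' ≠ 0`: C2 at the RIGHT end `U₂` (`β`), `t–t'` rectangle C1 at the LEFT end
`U₁` (`β_h < β`), every torus limit, no transport price.** C2 data at `(t, t', U₂)` as in
`eventually_typeFreeEntropy_mul_sq_le_log_partitionFn_allTori` (density `n (q a b) = 2A₀ ≤ 2`); C1: rectangle `a' × b'`
(`a', b' ≥ 2`) at `(β_h, μ, U₁)` with structured annihilator, dual `L_B`, constant `c` (`cornerEnergyRepTT'`). Then for
every `U ∈ [U₁, U₂]` and every torus limit `ω` of the canonical sector Gibbs states of `hubbardTorusTT' L t t' U` at `β`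
along any `Ls → ∞`: `e_Φ(ω) ≤ ((c − β_h μ n) − W)/(β − β_h)`, `W = (q log q − Σ m_s log m_s + Σ m_s log z_s)/(q a b)`.
[cite: Israel1979, Lemma II.3.1] [cite: PoulinHastings2011, eqs. (3)–(8)] [cite: Ruelle1969, §3.3] -/
theorem IsTorusLimitOfMixture.meanEnergy_hubbardTTPrime_le_of_typeClass_right_of_rectMarkovCertificateTT'_left_UCell_allTori
    (hn2 : n ≤ 2) {U₁ U₂ : ℝ} (hU : U ∈ Set.Icc U₁ U₂)
    (h : ω.IsTorusLimitOfMixture (sectorGibbsCount n) (fun L => sectorGibbsWeightTT' β t t' U n L)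
      (fun L => sectorGibbsVectorTT' t t' U n L) Ls)
    (hLs : Tendsto Ls atTop atTop) {βh : ℝ} (hβh : 0 < βh) (hlt : βh < β)
    -- C2 at `(β, U₂)`
    {a b : ℕ} (ha : 1 ≤ a) (hb : 1 ≤ b) (S : Finset (ℕ × ℕ)) (m : ℕ × ℕ → ℕ) {q A₀ : ℕ} (hq : 1 ≤ q)
    (hmS : ∀ s, m s ≠ 0 → s ∈ S) (hsum : ∑ s ∈ S, m s = q) (hA : ∑ s ∈ S, m s * s.1 = A₀)
    (hB : ∑ s ∈ S, m s * s.2 = A₀) (hn : n * ((q : ℝ) * a * b) = 2 * A₀) {z : ℕ × ℕ → ℝ}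
    (hz0 : ∀ s ∈ S, 0 < z s)
    (hz : ∀ s ∈ S, z s ≤ (partitionFn β (spinSectorHamiltonian s.1 s.2 (hubbardOpenBoxTT' a b t t' U₂))).re)
    -- C1 (`t–t'` rectangle) at `(βh, U₁)`
    (μ : ℝ) {a' b' : ℕ} (ha' : 2 ≤ a') (hb' : 2 ≤ b')
    {ι : Type*} (sι : Finset ι) (Sw : ι → Finset (Site 2)) (hS : ∀ i, Sw i ⊆ rectWindow a' b') (zw : ι → Site 2)
    (hzw : ∀ i, shiftSet (zw i) (Sw i) ⊆ rectWindow a' b') {O : ∀ i, FermionOp (Sw i)}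
    (hO : ∀ i ∈ sι, (O i).IsHermitian) (g : ι → ℝ)
    {LB : FermionOp ((rectWindow a' b').erase (mkSite2 (a' - 1) (b' - 1)))} (hLB : LB.IsHermitian) {c : ℝ}
    (hcert : ((Real.exp c : ℂ) • cfc Real.exp LB -
      fermionPartialTrace (PolySite.incl (Finset.erase_subset (mkSite2 (a' - 1) (b' - 1)) (rectWindow a' b')))
        (cfc Real.exp (-((βh : ℂ) • (cornerEnergyRepTT' (rectWindow a' b') (mkSite2 (a' - 1) (b' - 1)) t t' U₁ μ +
            windowAnnihilator sι (rectWindow a' b') Sw hS zw hzw O g)) +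
          fermionEmbed (PolySite.incl (Finset.erase_subset (mkSite2 (a' - 1) (b' - 1)) (rectWindow a' b'))) LB))).PosSemidef) :
    ω.meanEnergy (hubbardTTPrimeFermionInteraction t t' U) 1 ≤
      ((c - βh * μ * n) - ((q : ℝ) * Real.log q - ∑ s ∈ S, (m s : ℝ) * Real.log (m s) +
        ∑ s ∈ S, (m s : ℝ) * Real.log (z s)) / ((q : ℝ) * a * b)) / (β - βh) := by
  have hβ : 0 ≤ β := (hβh.trans hlt).le
  have hn0 : 0 ≤ n := density_nonneg_of_type ha hb hq hn
  have hA' := rectCorner_mem_rectWindow (a := a') (b := b') (by omega) (by omega)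
  refine h.meanEnergy_hubbardTTPrime_le_of_pressure_bounds_UCell hn0 hn2 hU hLs hβh hlt
    (fun _ hε => eventually_typeFreeEntropy_mul_sq_le_log_partitionFn_allTori t t' U₂ n hβ ha hb S m hq hmS hsum
      hA hB hn hn2 hz0 hz hLs hε)
    (fun ε hε => ?_)
  exact eventually_log_partitionFn_sectorHamiltonianTT'_le_of_clusterCertificateTT' t t' U₁ μ βh hn0 hn2 hLs hA'
    toLex_le_toLex_rectCorner (rectWindow_subset_halfOpenBox_max a' b')
    (fun i => bondWeightSum_cornerBondWeight hA' (rectCorner_sub_unitVec_mem_rectWindow ha' hb' i))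
    (diagBondWeightSum_cornerDiagBondWeight hA' (rectCorner_sub_unitVec_mem_rectWindow ha' hb' 0)
      (rectCorner_sub_unitVec_mem_rectWindow ha' hb' 1) (rectCorner_sub_unitVec_sub_unitVec_mem_rectWindow ha' hb'))
    (siteWeightSum_cornerSiteWeight hA') (siteWeightSum_mul_cornerSiteWeight hA' (-μ))
    (isHermitian_windowAnnihilator sι _ Sw hS zw hzw hO g)
    (fun L _ hL3 hℓL => trace_window_mul_windowAnnihilator
      (relabel_translate_gibbsDensity L (relabel_translate_hubbardTorusTT'_sub_mu (L := L) t t' U₁ μ) βh)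
      _ sι Sw hS zw hzw O g) hLB hcert hε

/-- **Lower edge on a whole `U`-CELL at `t' ≠ 0`: C2 at the RIGHT end `U₂` (`β`), `t–t'` rectangle C1 at the LEFT end
`U₁` at a colder `β_c > β`** (same data, C1 at `(β_c, μ, U₁)`): `(W − (c − β_c μ n))/(β_c − β) ≤ e_Φ(ω)` for every torus
limit at `(β, t, t', U, n)`, every `U ∈ [U₁, U₂]`. [cite: Israel1979, Lemma II.3.1] [cite: PoulinHastings2011, eqs. (3)–(8)]
[cite: Ruelle1969, §3.3] -/
theorem IsTorusLimitOfMixture.le_meanEnergy_hubbardTTPrime_of_typeClass_right_of_rectMarkovCertificateTT'_left_UCell_allTori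
    (hn2 : n ≤ 2) {U₁ U₂ : ℝ} (hU : U ∈ Set.Icc U₁ U₂)
    (h : ω.IsTorusLimitOfMixture (sectorGibbsCount n) (fun L => sectorGibbsWeightTT' β t t' U n L)
      (fun L => sectorGibbsVectorTT' t t' U n L) Ls)
    (hLs : Tendsto Ls atTop atTop) (hβ : 0 < β) {βc : ℝ} (hlt : β < βc)
    -- C2 at `(β, U₂)`
    {a b : ℕ} (ha : 1 ≤ a) (hb : 1 ≤ b) (S : Finset (ℕ × ℕ)) (m : ℕ × ℕ → ℕ) {q A₀ : ℕ} (hq : 1 ≤ q)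
    (hmS : ∀ s, m s ≠ 0 → s ∈ S) (hsum : ∑ s ∈ S, m s = q) (hA : ∑ s ∈ S, m s * s.1 = A₀)
    (hB : ∑ s ∈ S, m s * s.2 = A₀) (hn : n * ((q : ℝ) * a * b) = 2 * A₀) {z : ℕ × ℕ → ℝ}
    (hz0 : ∀ s ∈ S, 0 < z s)
    (hz : ∀ s ∈ S, z s ≤ (partitionFn β (spinSectorHamiltonian s.1 s.2 (hubbardOpenBoxTT' a b t t' U₂))).re)
    -- C1 (`t–t'` rectangle) at `(βc, U₁)`
    (μ : ℝ) {a' b' : ℕ} (ha' : 2 ≤ a') (hb' : 2 ≤ b')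
    {ι : Type*} (sι : Finset ι) (Sw : ι → Finset (Site 2)) (hS : ∀ i, Sw i ⊆ rectWindow a' b') (zw : ι → Site 2)
    (hzw : ∀ i, shiftSet (zw i) (Sw i) ⊆ rectWindow a' b') {O : ∀ i, FermionOp (Sw i)}
    (hO : ∀ i ∈ sι, (O i).IsHermitian) (g : ι → ℝ)
    {LB : FermionOp ((rectWindow a' b').erase (mkSite2 (a' - 1) (b' - 1)))} (hLB : LB.IsHermitian) {c : ℝ}
    (hcert : ((Real.exp c : ℂ) • cfc Real.exp LB -
      fermionPartialTrace (PolySite.incl (Finset.erase_subset (mkSite2 (a' - 1) (b' - 1)) (rectWindow a' b')))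
        (cfc Real.exp (-((βc : ℂ) • (cornerEnergyRepTT' (rectWindow a' b') (mkSite2 (a' - 1) (b' - 1)) t t' U₁ μ +
            windowAnnihilator sι (rectWindow a' b') Sw hS zw hzw O g)) +
          fermionEmbed (PolySite.incl (Finset.erase_subset (mkSite2 (a' - 1) (b' - 1)) (rectWindow a' b'))) LB))).PosSemidef) :
    (((q : ℝ) * Real.log q - ∑ s ∈ S, (m s : ℝ) * Real.log (m s) + ∑ s ∈ S, (m s : ℝ) * Real.log (z s)) /
        ((q : ℝ) * a * b) - (c - βc * μ * n)) / (βc - β) ≤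
      ω.meanEnergy (hubbardTTPrimeFermionInteraction t t' U) 1 := by
  have hn0 : 0 ≤ n := density_nonneg_of_type ha hb hq hn
  have hA' := rectCorner_mem_rectWindow (a := a') (b := b') (by omega) (by omega)
  refine h.le_meanEnergy_hubbardTTPrime_of_pressure_bounds_UCell hn0 hn2 hU hLs hβ hlt
    (fun _ hε => eventually_typeFreeEntropy_mul_sq_le_log_partitionFn_allTori t t' U₂ n hβ.le ha hb S m hq hmS
      hsum hA hB hn hn2 hz0 hz hLs hε)
    (fun ε hε => ?_)
  exact eventually_log_partitionFn_sectorHamiltonianTT'_le_of_clusterCertificateTT' t t' U₁ μ βc hn0 hn2 hLs hA'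
    toLex_le_toLex_rectCorner (rectWindow_subset_halfOpenBox_max a' b')
    (fun i => bondWeightSum_cornerBondWeight hA' (rectCorner_sub_unitVec_mem_rectWindow ha' hb' i))
    (diagBondWeightSum_cornerDiagBondWeight hA' (rectCorner_sub_unitVec_mem_rectWindow ha' hb' 0)
      (rectCorner_sub_unitVec_mem_rectWindow ha' hb' 1) (rectCorner_sub_unitVec_sub_unitVec_mem_rectWindow ha' hb'))
    (siteWeightSum_cornerSiteWeight hA') (siteWeightSum_mul_cornerSiteWeight hA' (-μ))
    (isHermitian_windowAnnihilator sι _ Sw hS zw hzw hO g)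
    (fun L _ hL3 hℓL => trace_window_mul_windowAnnihilator
      (relabel_translate_gibbsDensity L (relabel_translate_hubbardTorusTT'_sub_mu (L := L) t t' U₁ μ) βc)
      _ sι Sw hS zw hzw O g) hLB hcert hε

end CellTTPrime

end InfVolFermionState

end Literature.MathematicalPhysics.QuantumLattice

end
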